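import Literature.NumberTheory.LFunctions.LogDerivAtOneExplicitZeroSums
import Literature.NumberTheory.LFunctions.RealZeroGlobalLogDerivBound
import Literature.NumberTheory.LFunctions.KadiriDigammaBounds
import HarnessLib

/-!
# Táfula 2021, Propositions 3.1 and 3.2 — PROVED (discharges of `tafula2021_proposition31`,
# `tafula2021_proposition32` and, through 3.1, of `tafula2025_remark23`)

Topic `Literature/NumberTheory/LFunctions` (namespace `Literature.NumberTheory.LFunctions`, paper
vocabulary in `Tafula2021`); the PROOFS companion of `LogDerivAtOneExplicitZeroSums.lean` (statements,
r6-T11 of the cell `landau-siegel`, §C). Everything here is PROVED; no definitions, no named facts.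
**RH-free, GRH-free, abc-free.**

Main results:
* `tafula2021_proposition32_holds : tafula2021_proposition32` (appended 2026-08-27, see the section
  «Discharge of Proposition 3.2» at the end of the file: Lemma 3.4 (ii), the two-sided Lemma 3.3, the
  boxed indices `Z(χ) ∩ ℬ̃` of the doubled frame, and the assembly with `ε = (f log q)^{-1/2}`);
* `tafula2021_proposition31_holds : tafula2021_proposition31` — for every primitive `χ` mod `q ≥ 2`
  and every finite weighted set `𝒮` of non-trivial zeros of `L(s, χ)` (`1 ≤ w(ρ) ≤ m_χ(ρ)`),
  `Σ_{ρ∈𝒮} w(ρ) Re(1/(1 − ρ)) < (1 − 1/√5)·½·log q + Re(L'/L(1, χ)) + (1 + 1/√5)(2Σw + 3)/2 − 1`;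
* `tafula2025_remark23_holds : tafula2025_remark23` (via the tree's
  `Tafula2021.tafula2025_remark23_of_proposition31`);
* unconditional corollaries `Tafula2021.re_logDeriv_one_gt` (`Re L'/L(1,χ) > −0.2764·log q − 1.171`
  for EVERY primitive `χ` mod `q ≥ 2`) and `Tafula2021.one_div_sub_lt'` (the explicit one-zero
  dictionary `1/(1−β) < 0.2764·log q + Re L'/L(1,χ) + 2.618`), feeding `_holds` into the conditional
  theorems of the statements file.

## The printed proof and its transport to the tree (READ: arXiv:1911.07215 §3.1–3.2, chunks
## p0006:L20–L60, p0007:L60–L75)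

Notation of the source. `Z(χ)` = non-trivial zeros of `L(s,χ)` with multiplicity; the pairing
function `Π_ε(s) = 1/(s+ε) + 1/(s̄+ε) + 1/(1−s+ε) + 1/(1−s̄+ε)` ((3.3); `Tafula2021.pairing`); the
explicit formula in paired form (3.2): `Σ_{ρ∈Z(χ)} Π_{σ−1}(ρ)/4 = ½log(q/π) + Re L'/L(σ,χ) +
½Γ'/Γ((σ+a)/2)` for real `σ`; at `σ = 1` this is (3.4) with the constant
`G = ½(γ + log 2π + χ(−1) log 2) > 0`. Lemma 3.3 (ii): `|Σ Π_ε/4 − ½log q + G| < 1 + 1/ε`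
(`0 < ε < .85`); Lemma 3.4 (i): `Π₀(s) > Π_{φ−1}(s)/(2φ−1)` on the strip (`φ = (1+√5)/2`). Proof of
Proposition 3.1 (p0007:L60–L75): split `Z(χ)` into `𝒮̃ = 𝒮 ∪ (1 − 𝒮̄)` (`|𝒮̃| = 2|𝒮|`) and the rest; on
`𝒮̃` keep `½Re(1/ρ), ½Re(1/(1−ρ)) ≤ Π₀(ρ)/4`, on the rest use Lemma 3.4 (i) and then Lemma 3.3 (ii) at
`ε = φ − 1` together with `Π_ε/4 ≤ 1/ε`; drop `(1 − 1/(2φ−1))G > 0`.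

Transport. In the tree the natural object is the PAIR `Ξ_χ = ξ(·,χ)ξ(·,χ̄)` (`DirichletTheta.xiPair`;
genus-zero Hadamard product `exists_xiPair_hadamardSeq`, partial fractions `logDeriv_xiPair_eq_tsum`,
multiplicities `ncard_index_add_ncard_index_eq` — all PROVED, RH/GRH-free): its zero multiset is
`Z(χ) ⊎ Z(χ̄) = Z(χ) ⊎ conj Z(χ)`, listed by a Hadamard sequence `b` in pairs `{ρ_k, 1 − ρ_k}`
(`xiPairZero b k = ρ_k`), and `Ξ_χ'/Ξ_χ(s) = Σ_k T_k(s)`, `T_k(s) = 1/(s−ρ_k) + 1/(s−(1−ρ_k))`. At a real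
point `1 + ε`, `Re T_k(1+ε) = Π_ε(ρ_k)/2` (`re_term_eq_pairing_div_two`), so
`U(σ) := Σ_k Re T_k(σ) = Re Ξ_χ'/Ξ_χ(σ) = 2·Σ_{Z(χ)} Π_{σ−1}/4`, and every display of the source appears
DOUBLED:
* (3.2) ↦ `re_logDeriv_xiPair_ofReal`: `U(σ) = log q + 2Re Γ_ℝ'/Γ_ℝ(σ+κ) + 2Re L'/L(σ,χ)` (real
  `σ ≥ 1`; `ξ'/ξ = ½log q + Γ_ℝ'/Γ_ℝ + L'/L` for `χ`, `χ̄`, `Re L'/L(σ,χ̄) = Re L'/L(σ,χ)`); `G > 0` ↦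
  `re_logDeriv_Gammaℝ_ofReal_nonpos` (`Re Γ_ℝ'/Γ_ℝ(x) ≤ 0` for `0 < x ≤ 2`);
* Lemma 3.3 — only the LOWER half of (ii) is needed ↦ `re_logDeriv_LFunction_ofReal_ge`
  (`Re L'/L(σ,χ) ≥ −Σ Λ n^{−σ} = ζ'/ζ(σ) ≥ −1/(σ−1) + ½log π − ½Re ψ(σ/2+1)`; the tree's de la Vallée
  Poussin bound `neg_logDeriv_riemannZeta_re_le` replaces «`(σ−1)ζ(σ)` increasing»), plus the
  monotonicity of `ψ` on `(0, ∞)` (`KadiriDigamma.re_digamma_ofReal_mono`) for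
  `Γ'/Γ((σ+a)/2) ≥ Γ'/Γ((1+a)/2)`, `ψ(x) ≤ ψ(1) = −γ`, `ψ(x) ≤ ψ(2) = 1 − γ` (`x ≤ 1`, `x ≤ 2`);
* Lemma 3.4 (i) ↦ `Tafula2021.pairing_zero_gt` (statements file, PROVED there);
* `𝒮̃` ↦ `exists_index_finset`: the «half-terms» `(k, j)` carry the zeros `z_{k,0} = ρ_k`,
  `z_{k,1} = 1 − ρ_k`; the fibre over a zero `z` has `m_χ(z) + m_χ̄(z) = m_χ(z) + m_χ(z̄)` elements, so
  `w(z) + w(z̄)` of them can be picked over each `z ∈ 𝒮 ∪ conj 𝒮`; these `2|𝒮|` half-terms have values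
  `Re 1/(1−z)` adding up to `2Σ_𝒮 w Re(1/(1−ρ))`, at most the sum of the full terms
  `Re T_k(1) = Re 1/(1−ρ_k) + Re 1/ρ_k` over the (at most `2|𝒮|`) indices met (the conjugate `z̄` plays
  the part of the source's `1 − z̄`: in `Z(χ) ⊎ Z(χ̄)` it is `z̄ ∈ Z(χ̄)` that carries the value
  `Re 1/(1−z)` a second time);
* assembly ↦ `tafula2021_proposition31_holds`: `U(1) = Σ_I + Σ_{∉I} ≥ Σ_I Re T_k(1) + (1/√5)(U(φ) −
  Σ_I Re T_k(φ))`, `Re T_k(φ) ≤ 2/ε = 1 + √5` on `I`, then (3.2) at `1` and `φ`; the result is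
  `Σ_𝒮 w Re(1/(1−ρ)) ≤ (1−1/√5)½log q + Re L'/L(1,χ) + (φ/√5)·2|𝒮| + (1/√5)(φ − ½log π + ½Re ψ(φ/2+1))`,
  below the printed bound by the slack `1/√5` of the unused upper half of Lemma 3.3 (ii).

## References
* C. Táfula, *On Landau–Siegel zeros and heights of singular moduli*, Acta Arith. **201** (2021),
  1–28 = arXiv:1911.07215, §3. [Tafula2021]
* C. Táfula, Indag. Math. **36** (2025) 979–987 = arXiv:2001.02405, Remark 2.3. [Tafula2025]
* H. L. Montgomery, R. C. Vaughan, *Multiplicative Number Theory I*, §10.1–10.2. [MontgomeryVaughan2007]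

LABEL (cell rule): literature layer, sub-cell §C of the cell `landau-siegel` (reader r6), proof-only
(0 new facts, net debt −3). «The programme SEARCHES and TYPES; no claim about Landau–Siegel zeros,
Theorems 1–2 of arXiv:2211.02515 or a repaired Margin232 until a kernel theorem says so.»
-/

noncomputable section

open Complex Finset
open scoped ComplexConjugate

namespace Literature.NumberTheory.LFunctions

namespace Tafula2021

open DirichletTheta

variable {q : ℕ} [NeZero q] {χ : DirichletCharacter ℂ q} {b : ℕ → ℂ}

/-! ### Discharge of Proposition 3.1, part 1: the pairing function and the partial-fraction terms -/

/-- `Re(1/z) = Re z / (Re z² + Im z²)`. [folklore] -/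
private theorem re_inv_eq' (z : ℂ) : (z⁻¹).re = z.re / (z.re ^ 2 + z.im ^ 2) := by
  rw [Complex.inv_re, Complex.normSq_apply]; ring_nf

/-- `Π₀(ρ)/2 = Re(1/(1 − ρ)) + Re(1/ρ)` (the two halves kept by the printed proof:
«`½Re(1/ρ), ½Re(1/(1−ρ)) ≤ Π₀(ρ)/4`»). [cite: Tafula2021, §3.2, proof of Proposition 3.1 (arXiv p0007:L62)] -/
theorem pairing_zero_div_two (ρ : ℂ) : pairing 0 ρ / 2 = (1 / (1 - ρ)).re + (1 / ρ).re := by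
  rw [one_div, one_div, re_inv_eq', re_inv_eq', pairing]
  simp only [sub_re, sub_im, one_re, one_im, add_zero]
  ring

/-- For `0 < x`, `T ≥ 0`: `x/(x² + T) ≤ 1/x`. [folklore] -/
private theorem div_sq_add_le {x T : ℝ} (hx : 0 < x) (hT : 0 ≤ T) : x / (x ^ 2 + T) ≤ 1 / x := by
  rw [div_le_div_iff₀ (by positivity) hx]
  nlinarith

/-- `Π_ε(ρ) ≥ 0` for `ε ≥ 0` and `ρ` in the critical strip («since `Π_ε(ρ) > 0`»).
[cite: Tafula2021, Lemma 3.3 (proof, arXiv p0006:L44)] -/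
theorem pairing_nonneg {ε : ℝ} (hε : 0 ≤ ε) {ρ : ℂ} (h0 : 0 < ρ.re) (h1 : ρ.re < 1) :
    0 ≤ pairing ε ρ := by
  unfold pairing
  have : 0 < ρ.re + ε := by linarith
  have : 0 < 1 - ρ.re + ε := by linarith
  positivity

/-- `Π_ε(ρ)/2 ≤ 2/ε` for `ε > 0` and `ρ` in the strip («`Π_ε(ρ)/4 ≤ ε⁻¹`»).
[cite: Tafula2021, §3.2, proof of Proposition 3.1 (arXiv p0007:L63)] -/
theorem pairing_div_two_le {ε : ℝ} (hε : 0 < ε) {ρ : ℂ} (h0 : 0 < ρ.re) (h1 : ρ.re < 1) :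
    pairing ε ρ / 2 ≤ 2 / ε := by
  have ha : 0 < ρ.re + ε := by linarith
  have hb : 0 < 1 - ρ.re + ε := by linarith
  have e : pairing ε ρ / 2 = (ρ.re + ε) / ((ρ.re + ε) ^ 2 + ρ.im ^ 2) +
      (1 - ρ.re + ε) / ((1 - ρ.re + ε) ^ 2 + ρ.im ^ 2) := by
    rw [pairing]; ring
  rw [e]
  have h1' := div_sq_add_le ha (sq_nonneg ρ.im)
  have h2' := div_sq_add_le hb (sq_nonneg ρ.im)
  have h3 : 1 / (ρ.re + ε) ≤ 1 / ε := one_div_le_one_div_of_le hε (by linarith)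
  have h4 : 1 / (1 - ρ.re + ε) ≤ 1 / ε := one_div_le_one_div_of_le hε (by linarith)
  have e2 : (2 : ℝ) / ε = 1 / ε + 1 / ε := by ring
  linarith

/-- The `k`-th term of the partial-fraction series of `Ξ_χ'/Ξ_χ` at the real point `1 + ε` has real
part `Π_ε(ρ_k)/2` (for a live index `b_k ≠ 0`): `Re[1/(1+ε−ρ_k) + 1/(ε+ρ_k)]`; this is the tree form
of the source's (3.2) «`Σ_ρ Π_{σ−1}(ρ)/4 = ½ log(q/π) + Re L'/L(σ,χ) + ½Γ'/Γ((σ+a)/2)`», term by term.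
[cite: Tafula2021, §3.1 (3.2)–(3.3) (arXiv p0006:L27–L36)] -/
theorem re_term_eq_pairing_div_two (h2 : xiPair χ 2 ≠ 0)
    (hprod : ∀ z : ℂ, HasProd (fun n ↦ 1 - b n * (z ^ 2 - 9 / 4)) (xiPair χ (1 / 2 + z) / xiPair χ 2))
    {ε : ℝ} (hΞ : xiPair χ ((1 + ε : ℝ) : ℂ) ≠ 0) {k : ℕ} (hk : b k ≠ 0) :
    (-(2 * b k * (((1 + ε : ℝ) : ℂ) - 1 / 2)) /
        (1 - b k * ((((1 + ε : ℝ) : ℂ) - 1 / 2) ^ 2 - 9 / 4))).re = pairing ε (xiPairZero b k) / 2 := by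
  rw [DirichletTheta.term_eq_inv_add_inv b hk (factor_ne_zero_of_xiPair_ne_zero h2 hprod hΞ k), add_re, re_inv_eq',
    re_inv_eq', pairing]
  simp only [sub_re, sub_im, one_re, one_im, ofReal_re, ofReal_im]
  ring

/-- `(ρ_k − ½)² = 9/4 + 1/b_k`. [folklore] -/
private theorem xiPairZero_sub_half_sq' (b : ℕ → ℂ) (k : ℕ) :
    (xiPairZero b k - 1 / 2) ^ 2 = 9 / 4 + (b k)⁻¹ := by
  rw [xiPairZero, add_sub_cancel_left, Literature.Analysis.Complex.KiKim.cpow_half_sq]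

/-- The Hadamard indices whose pair `{ρ_k, 1 − ρ_k}` passes through a given point are finitely many
(`b_k` takes the fixed non-zero value `1/((z−½)² − 9/4)` there, and `b_k → 0`). [folklore] -/
private theorem finite_index (hbs : Summable fun n ↦ ‖b n‖) (z : ℂ) :
    {k : ℕ | b k ≠ 0 ∧ (xiPairZero b k = z ∨ 1 - xiPairZero b k = z)}.Finite := by
  set c : ℂ := ((z - 1 / 2) ^ 2 - 9 / 4)⁻¹ with hc
  have hsub : {k : ℕ | b k ≠ 0 ∧ (xiPairZero b k = z ∨ 1 - xiPairZero b k = z)} ⊆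
      {k | b k ≠ 0 ∧ b k = c} := by
    rintro k ⟨hk, h⟩
    refine ⟨hk, ?_⟩
    have hsq : (z - 1 / 2) ^ 2 = 9 / 4 + (b k)⁻¹ := by
      rcases h with h | h
      · rw [← h, xiPairZero_sub_half_sq']
      · rw [← h, ← xiPairZero_sub_half_sq' b k]; ring
    rw [hc, hsq, add_sub_cancel_left, inv_inv]
  refine Set.Finite.subset ?_ hsub
  by_cases hc0 : c = 0
  · have : {k : ℕ | b k ≠ 0 ∧ b k = c} = ∅ := by
      ext k
      simp only [Set.mem_setOf_eq, Set.mem_empty_iff_false, iff_false, not_and, hc0]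
      exact fun h h' ↦ h h'
    rw [this]; exact Set.finite_empty
  · have ht := (Summable.of_norm hbs).tendsto_cofinite_zero.norm
    rw [norm_zero] at ht
    have hev : ∀ᶠ k in Filter.cofinite, ‖b k‖ < ‖c‖ := ht.eventually (gt_mem_nhds (norm_pos_iff.2 hc0))
    refine (Filter.eventually_cofinite.1 hev).subset ?_
    rintro k ⟨-, hk⟩
    simp [hk]

/-- `m_{χ̄}(conj ρ) = m_χ(ρ)` (`conj L(conj s, χ) = L(s, χ̄)`); a copy of the tree's
`WeilConverseChar.zeroOrder_inv_conj` (not imported here). [cite: MontgomeryVaughan2007, §10.1 p. 334] -/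
private theorem zeroOrder_inv_conj' (h1 : χ ≠ 1) (ρ : ℂ) :
    DirichletDisc.zeroOrder χ⁻¹ (conj ρ) = DirichletDisc.zeroOrder χ ρ := by
  have hfun : χ⁻¹.LFunction = fun z ↦ conj (χ.LFunction (conj z)) :=
    funext fun z ↦ (DirichletZFR.conj_LFunction_conj χ h1 z).symm
  have han : AnalyticAt ℂ χ.LFunction (conj (conj ρ)) :=
    (DirichletCharacter.differentiable_LFunction h1).analyticAt _
  unfold DirichletDisc.zeroOrder analyticOrderNatAt
  rw [hfun, analyticOrderAt_conj_conj han, Complex.conj_conj]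

/-- `Re(1/(1 − conj z)) = Re(1/(1 − z))`. [folklore] -/
private theorem re_one_div_one_sub_conj (z : ℂ) : (1 / (1 - conj z)).re = (1 / (1 - z)).re := by
  have : (1 : ℂ) / (1 - conj z) = conj (1 / (1 - z)) := by
    rw [map_div₀, map_one, map_sub, map_one]
  rw [this, Complex.conj_re]


/-! ### Discharge of Proposition 3.1, part 2: (3.2) at a real point `σ ≥ 1`, and Lemma 3.3's inputs -/

/-- `Re L'/L(σ, χ̄) = Re L'/L(σ, χ)` at a real point (`χ ≠ 1`). [cite: MontgomeryVaughan2007, §10.1 p. 334] -/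
private theorem re_logDeriv_LFunction_inv_ofReal' (h1 : χ ≠ 1) (σ : ℝ) :
    (logDeriv χ⁻¹.LFunction σ).re = (logDeriv χ.LFunction σ).re := by
  have h := logDeriv_LFunction_conj (χ := χ) h1 (σ : ℂ)
  rw [Complex.conj_ofReal] at h
  rw [h, Complex.conj_re]

/-- **(3.2) in the doubled frame.** For a primitive `χ ≠ 1` and real `σ ≥ 1`:
`Re Ξ_χ'/Ξ_χ(σ) = log q + 2 Re Γ_ℝ'/Γ_ℝ(σ + κ) + 2 Re L'/L(σ, χ)` (`ξ'/ξ = ½ log q + Γ_ℝ'/Γ_ℝ + L'/L` for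
`χ` and `χ̄`, `Re L'/L(σ, χ̄) = Re L'/L(σ, χ)`); this is twice the right side of the source's (3.2)
`½ log(q/π) + Re L'/L(σ,χ) + ½Γ'/Γ((σ+a)/2)`. [cite: Tafula2021, §3.1 (3.2) (arXiv p0006:L27–L31)] -/
theorem re_logDeriv_xiPair_ofReal (hχ : χ.IsPrimitive) (h1 : χ ≠ 1) {σ : ℝ} (hσ : 1 ≤ σ) :
    (logDeriv (xiPair χ) σ).re =
      Real.log q + 2 * (logDeriv Gammaℝ ((σ : ℂ) + charParity χ)).re +
        2 * (deriv χ.LFunction σ / χ.LFunction σ).re := by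
  have h1' : χ⁻¹ ≠ 1 := inv_ne_one.mpr h1
  have hχ' : χ⁻¹.IsPrimitive := by
    rw [DirichletCharacter.isPrimitive_def, DirichletCharacter.conductor_inv]; exact hχ
  have hσre : 0 < ((σ : ℂ)).re := by simp only [ofReal_re]; linarith
  have hσ1 : (1 : ℝ) ≤ ((σ : ℂ)).re := by simp only [ofReal_re]; exact hσ
  have hLσ : χ.LFunction σ ≠ 0 :=
    DirichletCharacter.LFunction_ne_zero_of_one_le_re χ (Or.inl h1) hσ1
  have hLσ' : χ⁻¹.LFunction σ ≠ 0 :=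
    DirichletCharacter.LFunction_ne_zero_of_one_le_re χ⁻¹ (Or.inl h1') hσ1
  have hξ : dirichletXi χ σ ≠ 0 := dirichletXi_ne_zero_of_not_mem_strip hχ h1 (Or.inr hσ1)
  have hξ' : dirichletXi χ⁻¹ σ ≠ 0 := dirichletXi_ne_zero_of_not_mem_strip hχ' h1' (Or.inr hσ1)
  have hmul : logDeriv (xiPair χ) σ = logDeriv (dirichletXi χ) σ + logDeriv (dirichletXi χ⁻¹) σ := by
    have hfun : xiPair χ = fun s ↦ dirichletXi χ s * dirichletXi χ⁻¹ s := rfl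
    rw [hfun, logDeriv_mul (σ : ℂ) hξ hξ' (differentiable_dirichletXi h1 _)
      (differentiable_dirichletXi h1' _)]
  have e1 : logDeriv (dirichletXi χ) σ =
      (Real.log q : ℂ) / 2 + logDeriv Gammaℝ ((σ : ℂ) + charParity χ) + logDeriv χ.LFunction σ := by
    rw [logDeriv_apply]; exact logDeriv_dirichletXi_eq h1 hσre hLσ
  have e2 : logDeriv (dirichletXi χ⁻¹) σ =
      (Real.log q : ℂ) / 2 + logDeriv Gammaℝ ((σ : ℂ) + charParity χ) + logDeriv χ⁻¹.LFunction σ := by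
    rw [logDeriv_apply, ← charParity_inv χ]; exact logDeriv_dirichletXi_eq h1' hσre hLσ'
  have hre := congrArg Complex.re hmul
  rw [e1, e2] at hre
  simp only [add_re, div_ofNat_re, ofReal_re] at hre
  rw [re_logDeriv_LFunction_inv_ofReal' h1] at hre
  rw [← logDeriv_apply, hre]; ring

/-- `Re Γ_ℝ'/Γ_ℝ(x) = −½ log π + ½ Re ψ(x/2)` for real `x > 0`. [folklore] -/
private theorem re_logDeriv_Gammaℝ_ofReal' {x : ℝ} (hx : 0 < x) :
    (logDeriv Gammaℝ (x : ℂ)).re = -Real.log Real.pi / 2 + (digamma ((x / 2 : ℝ) : ℂ)).re / 2 := by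
  have hs : ∀ m : ℕ, (x : ℂ) / 2 ≠ -m := fun m h ↦ by
    have := congrArg Complex.re h
    simp at this
    have hm : (0 : ℝ) ≤ m := m.cast_nonneg
    linarith
  rw [Literature.NumberTheory.LFunctions.logDeriv_Gammaℝ hs, add_re, div_ofNat_re, neg_re, log_ofReal_re,
    div_ofNat_re]
  push_cast
  ring

/-- `x ↦ Re Γ_ℝ'/Γ_ℝ(x)` is non-decreasing on `(0, ∞)` (as `ψ` is; «`Γ'/Γ(σ)` is strictly increasing»).
[cite: Tafula2021, Lemma 3.3 (proof, arXiv p0006:L44)] -/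
private theorem re_logDeriv_Gammaℝ_ofReal_mono {x y : ℝ} (hx : 0 < x) (hxy : x ≤ y) :
    (logDeriv Gammaℝ (x : ℂ)).re ≤ (logDeriv Gammaℝ (y : ℂ)).re := by
  rw [re_logDeriv_Gammaℝ_ofReal' hx, re_logDeriv_Gammaℝ_ofReal' (lt_of_lt_of_le hx hxy)]
  have := KadiriDigamma.re_digamma_ofReal_mono (a := x / 2) (b := y / 2) (by linarith) (by linarith)
  linarith

/-- `Re Γ_ℝ'/Γ_ℝ(x) ≤ 0` for `0 < x ≤ 2` (`ψ(x/2) ≤ ψ(1) = −γ < 0 < log π`), i.e. the source's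
`G = ½(γ + log 2π + χ(−1) log 2) > 0`. [cite: Tafula2021, §3.1 (3.4) (arXiv p0006:L36–L38)] -/
private theorem re_logDeriv_Gammaℝ_ofReal_nonpos {x : ℝ} (hx : 0 < x) (hx2 : x ≤ 2) :
    (logDeriv Gammaℝ (x : ℂ)).re ≤ 0 := by
  rw [re_logDeriv_Gammaℝ_ofReal' hx]
  have hmono := KadiriDigamma.re_digamma_ofReal_mono (a := x / 2) (b := 1) (by linarith) (by linarith)
  have h1 : (digamma ((1 : ℝ) : ℂ)).re = -Real.eulerMascheroniConstant := by
    rw [Complex.ofReal_one, Complex.digamma_one]; simp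
  have hγ := Real.one_half_lt_eulerMascheroniConstant
  have hπ : 0 < Real.log Real.pi := Real.log_pos (by linarith [Real.pi_gt_three])
  linarith

/-- `Re ψ(x) ≤ 1 − γ` for real `0 < x ≤ 2` (`ψ` increasing, `ψ(2) = ψ(1) + 1 = 1 − γ`). [folklore] -/
private theorem re_digamma_le_one_sub {x : ℝ} (hx : 0 < x) (hx2 : x ≤ 2) :
    (digamma (x : ℂ)).re ≤ 1 - Real.eulerMascheroniConstant := by
  have hmono := KadiriDigamma.re_digamma_ofReal_mono hx hx2
  have h2 : digamma ((2 : ℝ) : ℂ) = 1 - Real.eulerMascheroniConstant := by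
    have h := Complex.digamma_apply_add_one (1 : ℂ) (fun m ↦ by
      intro h
      have := congrArg Complex.re h
      simp at this
      have : (0 : ℝ) ≤ m := Nat.cast_nonneg m
      linarith)
    rw [Complex.digamma_one] at h
    rw [show ((2 : ℝ) : ℂ) = 1 + 1 by push_cast; norm_num, h]
    simp; ring
  have e : (digamma ((2 : ℝ) : ℂ)).re = 1 - Real.eulerMascheroniConstant := by
    rw [h2, show (1 - Real.eulerMascheroniConstant : ℂ) = ((1 - Real.eulerMascheroniConstant : ℝ) : ℂ) by
      push_cast; ring, Complex.ofReal_re]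
  linarith

/-- **Lemma 3.3's analytic input (lower half only).** For real `σ > 1`:
`Re L'/L(σ, χ) ≥ −Σ Λ(n)n^{−σ} = ζ'/ζ(σ) ≥ −1/(σ−1) + ½ log π − ½ Re ψ(σ/2 + 1)` («`Re L'/L(1+ε,χ) ≤
|ζ'/ζ(1+ε)| < 1/ε`»; the tree's `neg_logDeriv_riemannZeta_re_le` replaces `(σ−1)ζ(σ)` increasing).
[cite: Tafula2021, Lemma 3.3 (proof, arXiv p0006:L44–L47)] -/
theorem re_logDeriv_LFunction_ofReal_ge (χ : DirichletCharacter ℂ q) {σ : ℝ} (hσ : 1 < σ) :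
    -(1 / (σ - 1) - Real.log Real.pi / 2 + (digamma ((σ : ℂ) / 2 + 1)).re / 2) ≤
      (deriv χ.LFunction σ / χ.LFunction σ).re := by
  have hs : 1 < ((σ : ℂ)).re := by simp [hσ]
  have hnorm : ‖deriv χ.LFunction σ / χ.LFunction σ‖ ≤
      ∑' n : ℕ, ArithmeticFunction.vonMangoldt n / (n : ℝ) ^ σ := by
    rw [← norm_neg, DirichletZFR.neg_logDeriv_LFunction_eq χ hs]
    have := (DirichletZFR.norm_LSeries_twist_le χ hs).2
    simpa only [ofReal_re] using this
  have hzeta : (∑' n : ℕ, ArithmeticFunction.vonMangoldt n / (n : ℝ) ^ σ) =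
      (-(deriv riemannZeta σ / riemannZeta σ)).re := by
    have h := DirichletZFR.LSeries_vonMangoldt_ofReal hσ
    rw [ArithmeticFunction.LSeries_vonMangoldt_eq_deriv_riemannZeta_div hs] at h
    have h' := congrArg Complex.re h
    rw [ofReal_re] at h'
    rw [← h', neg_div]
  have hζ := neg_logDeriv_riemannZeta_re_le hσ
  have hre : -‖deriv χ.LFunction σ / χ.LFunction σ‖ ≤ (deriv χ.LFunction σ / χ.LFunction σ).re :=
    (abs_le.1 (Complex.abs_re_le_norm _)).1
  linarith


/-! ### Discharge of Proposition 3.1, part 3: the sub-multiset `𝒮̃` (selection of Hadamard indices)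

The printed proof splits `Z(χ)` into `𝒮̃ = 𝒮 ∪ (1 − 𝒮̄)` (`|𝒮̃| = 2|𝒮|`) and its complement and keeps,
on `𝒮̃`, only the halves `½Re(1/(1−ρ))`, `½Re(1/ρ)` of `Π₀(ρ)/4`.  In the doubled frame of `Ξ_χ`
(zero multiset `Z(χ) ⊎ Z(χ̄) = Z(χ) ⊎ conj Z(χ)`, organised in Hadamard pairs `{ρ_k, 1 − ρ_k}`) this is
the following selection: the «half-terms» `(k, j)` carry the zeros `z_{k,0} = ρ_k`, `z_{k,1} = 1 − ρ_k`,
the fibre over a zero `z` has `m_χ(z) + m_χ̄(z) = m_χ(z) + m_χ(z̄)` elements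
(`ncard_index_add_ncard_index_eq`, `m_χ̄(z) = m_χ(z̄)`), so one can pick `w(z) + w(z̄)` of them over
each `z ∈ 𝒮 ∪ conj 𝒮`; the chosen half-terms number `2|𝒮|` and their values `Re 1/(1−z)` add up to
`2 Σ_{ρ∈𝒮} w(ρ) Re(1/(1−ρ))`, which is at most the sum of the full terms `Re 1/(1−ρ_k) + Re 1/ρ_k` over the
(at most `2|𝒮|`) indices `k` met. -/

/-- **Selection of the indices (the `𝒮̃` of the printed proof).**  For a Hadamard sequence `b` of
`Ξ_χ` and a weighted finite set `𝒮` of non-trivial zeros of `L(s, χ)` (`1 ≤ w(ρ) ≤ m_χ(ρ)`), there is a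
finite set `I` of live indices, `|I| ≤ 2 Σ w`, with
`2 Σ_{ρ∈𝒮} w(ρ) Re(1/(1−ρ)) ≤ Σ_{k∈I} (Re 1/(1−ρ_k) + Re 1/ρ_k)`.
[cite: Tafula2021, §3.2, proof of Proposition 3.1, first display (arXiv p0007:L61–L66)] -/
theorem exists_index_finset (hχ : χ.IsPrimitive) (h1 : χ ≠ 1) (hbs : Summable fun n ↦ ‖b n‖)
    (h2 : xiPair χ 2 ≠ 0)
    (hmult : ∀ a : ℂ, a ≠ 0 →
      {n : ℕ | b n = a⁻¹}.ncard = analyticOrderNatAt (fun w ↦ xiPairLift χ (w + 9 / 4)) a)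
    (hprod : ∀ z : ℂ, HasProd (fun n ↦ 1 - b n * (z ^ 2 - 9 / 4)) (xiPair χ (1 / 2 + z) / xiPair χ 2))
    (S : Finset ℂ) (w : ℂ → ℕ)
    (hS : ∀ ρ ∈ S, 0 < ρ.re ∧ ρ.re < 1 ∧ 1 ≤ w ρ ∧ w ρ ≤ DirichletDisc.zeroOrder χ ρ) :
    ∃ I : Finset ℕ, (∀ k ∈ I, b k ≠ 0) ∧ I.card ≤ 2 * ∑ ρ ∈ S, w ρ ∧
      2 * ∑ ρ ∈ S, (w ρ : ℝ) * (1 / (1 - ρ)).re ≤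
        ∑ k ∈ I, ((1 / (1 - xiPairZero b k)).re + (1 / xiPairZero b k).re) := by
  classical
  -- extended weights, the conj-closed support, the demand `d`, the value map on half-terms
  set w' : ℂ → ℕ := fun z ↦ if z ∈ S then w z else 0 with hw'
  set S' : Finset ℂ := S ∪ S.image conj with hS'
  set d : ℂ → ℕ := fun z ↦ w' z + w' (conj z) with hd
  set zv : ℕ × Bool → ℂ := fun p ↦ if p.2 then 1 - xiPairZero b p.1 else xiPairZero b p.1 with hzv
  set f : ℂ → ℝ := fun z ↦ (1 / (1 - z)).re with hf
  have hSsub : S ⊆ S' := Finset.subset_union_left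
  -- `S'` consists of zeros of `Ξ_χ` in the strip
  have hS'mem : ∀ z ∈ S', z ∈ S ∨ conj z ∈ S := by
    intro z hz
    rcases Finset.mem_union.1 hz with h | h
    · exact Or.inl h
    · obtain ⟨u, hu, rfl⟩ := Finset.mem_image.1 h
      exact Or.inr (by simpa using hu)
  have hSzero : ∀ z ∈ S, xiPair χ z = 0 := by
    intro z hz
    obtain ⟨h0, h1z, hw1, hwle⟩ := hS z hz
    have hL : χ.LFunction z = 0 := (DirichletDisc.zeroOrder_pos_iff χ h1 z).1 (by omega)
    have hξ : dirichletXi χ z = 0 :=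
      (dirichletXi_eq_zero_iff_mem_charNontrivialZeros hχ h1 z).2 ⟨hL, h0, h1z⟩
    show dirichletXi χ z * dirichletXi χ⁻¹ z = 0
    rw [hξ, zero_mul]
  have hS'zero : ∀ z ∈ S', xiPair χ z = 0 := by
    intro z hz
    rcases hS'mem z hz with h | h
    · exact hSzero z h
    · have := congrArg conj (hSzero (conj z) h)
      rwa [conj_xiPair h1, Complex.conj_conj, map_zero] at this
  have hS'strip : ∀ z ∈ S', 0 < z.re ∧ z.re < 1 := fun z hz ↦ re_mem_Ioo_of_xiPair_eq_zero hχ h1 (hS'zero z hz)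
  -- `w' ≤ m_χ` everywhere, and `d ≤ m_χ + m_χ̄`
  have hw'le : ∀ z, w' z ≤ DirichletDisc.zeroOrder χ z := by
    intro z
    by_cases hz : z ∈ S
    · simp only [hw', hz, if_true]; exact (hS z hz).2.2.2
    · simp only [hw', hz, if_false]; exact Nat.zero_le _
  have hdle : ∀ z, d z ≤ DirichletDisc.zeroOrder χ z + DirichletDisc.zeroOrder χ⁻¹ z := by
    intro z
    have hconj : DirichletDisc.zeroOrder χ⁻¹ z = DirichletDisc.zeroOrder χ (conj z) := by
      rw [← zeroOrder_inv_conj' h1 (conj z), Complex.conj_conj]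
    rw [hconj]
    exact add_le_add (hw'le z) (hw'le (conj z))
  -- the fibres of half-terms over the points of `S'`
  have hfib : ∀ z ∈ S', ∃ H : Finset (ℕ × Bool), (∀ p ∈ H, b p.1 ≠ 0 ∧ zv p = z) ∧ d z ≤ H.card := by
    intro z hz
    have hfinA : {k : ℕ | b k ≠ 0 ∧ xiPairZero b k = z}.Finite :=
      (finite_index hbs z).subset fun k hk ↦ ⟨hk.1, Or.inl hk.2⟩
    have hfinB : {k : ℕ | b k ≠ 0 ∧ 1 - xiPairZero b k = z}.Finite :=
      (finite_index hbs z).subset fun k hk ↦ ⟨hk.1, Or.inr hk.2⟩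
    refine ⟨hfinA.toFinset ×ˢ {false} ∪ hfinB.toFinset ×ˢ {true}, ?_, ?_⟩
    · intro p hp
      simp only [Finset.mem_union, Finset.mem_product, Set.Finite.mem_toFinset, Set.mem_setOf_eq,
        Finset.mem_singleton] at hp
      rcases hp with ⟨⟨hb0, hz'⟩, hp2⟩ | ⟨⟨hb0, hz'⟩, hp2⟩
      · exact ⟨hb0, by simp [hzv, hp2, hz']⟩
      · exact ⟨hb0, by simp [hzv, hp2, hz']⟩
    · have hdisj : Disjoint (hfinA.toFinset ×ˢ ({false} : Finset Bool))
          (hfinB.toFinset ×ˢ ({true} : Finset Bool)) := by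
        rw [Finset.disjoint_left]
        rintro ⟨k, c⟩ hA hB
        rw [Finset.mem_product, Finset.mem_singleton] at hA hB
        exact Bool.false_ne_true (hA.2.symm.trans hB.2)
      rw [Finset.card_union_of_disjoint hdisj, Finset.card_product, Finset.card_product,
        Finset.card_singleton, Finset.card_singleton, mul_one, mul_one,
        ← Set.ncard_eq_toFinset_card _ hfinA, ← Set.ncard_eq_toFinset_card _ hfinB,
        ncard_index_add_ncard_index_eq hχ h1 hmult (hS'zero z hz)]
      exact hdle z
  choose! H hHmem hHcard using hfib
  have hJex : ∀ z ∈ S', ∃ J : Finset (ℕ × Bool), J ⊆ H z ∧ J.card = d z :=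
    fun z hz ↦ Finset.exists_subset_card_eq (hHcard z hz)
  choose! J hJsub hJcard using hJex
  have hJval : ∀ z ∈ S', ∀ p ∈ J z, b p.1 ≠ 0 ∧ zv p = z :=
    fun z hz p hp ↦ hHmem z hz p (hJsub z hz hp)
  have hdisjJ : (S' : Set ℂ).PairwiseDisjoint J := by
    intro z hz z' hz' hne
    rw [Function.onFun, Finset.disjoint_left]
    intro p hp hp'
    exact hne ((hJval z hz p hp).2.symm.trans (hJval z' hz' p hp').2)
  -- bookkeeping on `S'`: it is `conj`-closed, `Σ_{S'} w' = Σ_S w`, and sums are `conj`-invariant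
  have hS'im : S'.image conj = S' := by
    rw [hS', Finset.image_union, Finset.image_image]
    have hcc : ((starRingEnd ℂ : ℂ → ℂ) ∘ (starRingEnd ℂ : ℂ → ℂ)) = id := by
      funext z; exact Complex.conj_conj z
    rw [hcc, Finset.image_id, Finset.union_comm]
  have hsum_conj : ∀ g : ℂ → ℝ, ∑ z ∈ S', g (conj z) = ∑ z ∈ S', g z := by
    intro g
    have hinj : ∀ x ∈ S', ∀ y ∈ S', conj x = conj y → x = y :=
      fun x _ y _ h ↦ by simpa using congrArg conj h
    rw [← Finset.sum_image hinj, hS'im]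
  have hsum_w' : ∀ g : ℂ → ℝ, ∑ z ∈ S', (w' z : ℝ) * g z = ∑ z ∈ S, (w z : ℝ) * g z := by
    intro g
    have : ∀ z ∈ S', (w' z : ℝ) * g z = if z ∈ S then (w z : ℝ) * g z else 0 := by
      intro z _
      by_cases hz : z ∈ S
      · simp [hw', hz]
      · simp [hw', hz]
    rw [Finset.sum_congr rfl this, Finset.sum_ite_mem, Finset.inter_eq_right.2 hSsub]
  have hdsum_real : ∑ z ∈ S', (d z : ℝ) = 2 * ∑ ρ ∈ S, (w ρ : ℝ) := by
    have e : ∀ z ∈ S', (d z : ℝ) = (w' z : ℝ) * 1 + (w' (conj z) : ℝ) * 1 := by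
      intro z _; simp [hd]
    rw [Finset.sum_congr rfl e, Finset.sum_add_distrib,
      hsum_conj (fun z ↦ (w' z : ℝ) * 1), hsum_w']
    simp only [mul_one]; ring
  have hdsum : ∑ z ∈ S', d z = 2 * ∑ ρ ∈ S, w ρ := by
    exact_mod_cast hdsum_real
  -- the selected half-terms and indices
  set Jall : Finset (ℕ × Bool) := S'.biUnion J with hJall
  refine ⟨Jall.image Prod.fst, ?_, ?_, ?_⟩
  · intro k hk
    obtain ⟨p, hp, rfl⟩ := Finset.mem_image.1 hk
    obtain ⟨z, hz, hpz⟩ := Finset.mem_biUnion.1 hp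
    exact (hJval z hz p hpz).1
  · calc (Jall.image Prod.fst).card ≤ Jall.card := Finset.card_image_le
      _ = ∑ z ∈ S', (J z).card := Finset.card_biUnion hdisjJ
      _ = ∑ z ∈ S', d z := Finset.sum_congr rfl fun z hz ↦ hJcard z hz
      _ = 2 * ∑ ρ ∈ S, w ρ := hdsum
  · -- value of the selected half-terms
    have hval : ∑ p ∈ Jall, f (zv p) = 2 * ∑ ρ ∈ S, (w ρ : ℝ) * (1 / (1 - ρ)).re := by
      rw [hJall, Finset.sum_biUnion hdisjJ]
      have e : ∀ z ∈ S', ∑ p ∈ J z, f (zv p) = (d z : ℝ) * f z := by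
        intro z hz
        rw [Finset.sum_congr rfl fun p hp ↦ by rw [(hJval z hz p hp).2], Finset.sum_const, hJcard z hz,
          nsmul_eq_mul]
      rw [Finset.sum_congr rfl e]
      have e2 : ∀ z ∈ S', (d z : ℝ) * f z = (w' z : ℝ) * f z + (w' (conj z) : ℝ) * f (conj z) := by
        intro z _
        have hfc : f (conj z) = f z := re_one_div_one_sub_conj z
        simp only [hd, hfc]; push_cast; ring
      rw [Finset.sum_congr rfl e2, Finset.sum_add_distrib, hsum_conj (fun z ↦ (w' z : ℝ) * f z),
        hsum_w']
      ring
    -- comparison with the full terms over the indices met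
    have hmaps : ∀ p ∈ Jall, p.1 ∈ Jall.image Prod.fst := fun p hp ↦ Finset.mem_image_of_mem _ hp
    rw [← hval, ← Finset.sum_fiberwise_of_maps_to hmaps]
    refine Finset.sum_le_sum fun k hk ↦ ?_
    obtain ⟨p₀, hp₀, hk₀⟩ := Finset.mem_image.1 hk
    obtain ⟨z₀, hz₀, hpz₀⟩ := Finset.mem_biUnion.1 hp₀
    have hbk : b k ≠ 0 := hk₀ ▸ (hJval z₀ hz₀ p₀ hpz₀).1
    have hρ : 0 < (xiPairZero b k).re ∧ (xiPairZero b k).re < 1 :=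
      re_mem_Ioo_of_xiPair_eq_zero hχ h1 (xiPair_xiPairZero h2 hprod hbk)
    have hsub : (Jall.filter fun p ↦ p.1 = k) ⊆ {(k, false), (k, true)} := by
      intro p hp
      rw [Finset.mem_filter] at hp
      rcases p with ⟨k', c⟩
      rcases hp with ⟨-, rfl⟩
      cases c <;> simp
    have hnonneg : ∀ p ∈ ({(k, false), (k, true)} : Finset (ℕ × Bool)), 0 ≤ f (zv p) := by
      intro p hp
      simp only [Finset.mem_insert, Finset.mem_singleton] at hp
      rcases hp with rfl | rfl
      · simp only [hzv, hf, Bool.false_eq_true, if_false, one_div, re_inv_eq']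
        refine div_nonneg ?_ (by positivity)
        simp only [sub_re, one_re]; linarith [hρ.2]
      · simp only [hzv, hf, if_true, one_div, re_inv_eq', sub_sub_cancel]
        exact div_nonneg hρ.1.le (by positivity)
    calc ∑ p ∈ Jall.filter (fun p ↦ p.1 = k), f (zv p)
        ≤ ∑ p ∈ ({(k, false), (k, true)} : Finset (ℕ × Bool)), f (zv p) :=
          Finset.sum_le_sum_of_subset_of_nonneg hsub fun p hp _ ↦ hnonneg p hp
      _ = f (xiPairZero b k) + f (1 - xiPairZero b k) := by
          rw [Finset.sum_pair (by simp)]; simp [hzv]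
      _ = (1 / (1 - xiPairZero b k)).re + (1 / xiPairZero b k).re := by
          simp only [hf, sub_sub_cancel]


/-! ### Discharge of Proposition 3.1, part 4: assembly (arXiv p0007:L60–L75) -/

/-- A primitive character modulo `q ≥ 2` is not principal. [folklore] -/
private theorem ne_one_of_isPrimitive'' {q : ℕ} [NeZero q] (hq : 2 ≤ q) {χ : DirichletCharacter ℂ q}
    (hχ : χ.IsPrimitive) : χ ≠ 1 := by
  intro h1
  have hc := (DirichletCharacter.isPrimitive_def χ).mp hχ
  rw [h1, DirichletCharacter.conductor_one] at hc
  omega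

/-- `2 < √5`. [folklore] -/
private theorem two_lt_sqrt_five : (2 : ℝ) < Real.sqrt 5 := by
  rw [show (2 : ℝ) = Real.sqrt (2 ^ 2) by rw [Real.sqrt_sq (by norm_num)]]
  exact Real.sqrt_lt_sqrt (by norm_num) (by norm_num)

/-- `√5 < 3`. [folklore] -/
private theorem sqrt_five_lt_three : Real.sqrt 5 < 3 := by
  rw [show (3 : ℝ) = Real.sqrt (3 ^ 2) by rw [Real.sqrt_sq (by norm_num)]]
  exact Real.sqrt_lt_sqrt (by norm_num) (by norm_num)

/-- **Táfula 2021, Proposition 3.1 — PROVED** (discharge of the named fact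
`Literature.NumberTheory.LFunctions.tafula2021_proposition31`, following the printed proof of §3.2 in
the doubled frame of `Ξ_χ = ξ(·,χ)ξ(·,χ̄)`): with `U(σ) = Σ_k Re T_k(σ) = Re Ξ_χ'/Ξ_χ(σ) =
log q + 2Re Γ_ℝ'/Γ_ℝ(σ+κ) + 2Re L'/L(σ,χ)` ((3.2) doubled), the indices `I` of `exists_index_finset`
(`𝒮̃`), Lemma 3.4 (i) on the complement of `I` (`pairing_zero_gt`), `Re T_k(φ) ≤ 2/ε` on `I`, and the
lower half of Lemma 3.3 (ii) at `σ = φ = 1 + ε` (`re_logDeriv_LFunction_ofReal_ge`, monotonicity of `ψ`,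
`G > 0`), one gets `Σ_𝒮 w Re(1/(1−ρ)) ≤ (1−1/√5)½log q + Re L'/L(1,χ) + (φ/√5)(2|𝒮| + 1) +
(1/√5)(½Re ψ(φ/2+1) − ½log π)`, which is less than the printed bound (the printed constant carries an
extra `1/√5` from the unused upper half of Lemma 3.3 (ii)).
[cite: Tafula2021, Proposition 3.1 and its proof, §3.2 (arXiv p0006:L5–L7, p0007:L60–L75)] -/
theorem _root_.Literature.NumberTheory.LFunctions.tafula2021_proposition31_holds :
    tafula2021_proposition31 := by
  intro q _ hq χ hχ S w hS
  classical
  have h1 : χ ≠ 1 := ne_one_of_isPrimitive'' hq hχ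
  obtain ⟨b, hbs, -, hmult, hprod⟩ := exists_xiPair_hadamardSeq hχ h1
  have h2 : xiPair χ 2 ≠ 0 := xiPair_two_ne_zero hχ h1
  -- the constants `√5`, `φ = (1 + √5)/2`, `ε = φ − 1 = 1/φ`
  have h5 : Real.sqrt 5 ^ 2 = 5 := Real.sq_sqrt (by norm_num)
  have h5gt := two_lt_sqrt_five
  have h5lt := sqrt_five_lt_three
  have hs5pos : 0 < Real.sqrt 5 := by linarith
  have hs5ne : Real.sqrt 5 ≠ 0 := hs5pos.ne'
  obtain ⟨φ, hφ⟩ : ∃ φ : ℝ, φ = (1 + Real.sqrt 5) / 2 := ⟨_, rfl⟩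
  have hφ1 : 1 < φ := by rw [hφ]; linarith
  have hφ2 : φ < 2 := by rw [hφ]; linarith
  have hεφ : (φ - 1) * φ = 1 := by rw [hφ]; nlinarith [h5]
  have hinvε : 1 / (φ - 1) = φ := by
    rw [div_eq_iff (by linarith : φ - 1 ≠ 0)]; linarith [hεφ]
  have h2φ : 2 * φ - 1 = Real.sqrt 5 := by rw [hφ]; ring
  have h2φ' : 1 + Real.sqrt 5 = 2 * φ := by rw [hφ]; ring
  -- `Ξ_χ ≠ 0` at the real points `σ ≥ 1`
  have hΞne : ∀ σ : ℝ, 1 ≤ σ → xiPair χ (σ : ℂ) ≠ 0 := by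
    intro σ hσ h
    have := (re_mem_Ioo_of_xiPair_eq_zero hχ h1 h).2
    simp only [ofReal_re] at this
    linarith
  -- the terms of the partial-fraction series of `Ξ_χ'/Ξ_χ` at a real point `σ`
  obtain ⟨T, hT⟩ : ∃ T : ℝ → ℕ → ℂ, T = fun (σ : ℝ) (n : ℕ) ↦
      -(2 * b n * ((σ : ℂ) - 1 / 2)) / (1 - b n * (((σ : ℂ) - 1 / 2) ^ 2 - 9 / 4)) := ⟨_, rfl⟩
  have hTs : ∀ σ : ℝ, Summable (T σ) := fun σ ↦ by
    rw [hT]; exact summable_logDeriv_factor hbs (9 / 4) ((σ : ℂ) - 1 / 2)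
  have hTre : ∀ σ : ℝ, Summable fun n ↦ (T σ n).re := fun σ ↦
    (Complex.hasSum_re (hTs σ).hasSum).summable
  -- **(3.2) doubled**: `U(σ) = Σ_k Re T_k(σ) = log q + 2 Re Γ_ℝ'/Γ_ℝ(σ+κ) + 2 Re L'/L(σ,χ)`
  have hU : ∀ σ : ℝ, 1 ≤ σ → ∑' n, (T σ n).re = Real.log q +
      2 * (logDeriv Gammaℝ ((σ : ℂ) + charParity χ)).re +
        2 * (deriv χ.LFunction σ / χ.LFunction σ).re := by
    intro σ hσ
    rw [← re_logDeriv_xiPair_ofReal hχ h1 hσ, logDeriv_xiPair_eq_tsum hbs h2 h1 hprod (hΞne σ hσ),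
      Complex.re_tsum (summable_logDeriv_factor hbs (9 / 4) ((σ : ℂ) - 1 / 2)), hT]
  -- the zeros `ρ_k` and the real parts of the terms at `σ = 1` and `σ = φ`
  have hρ : ∀ k, b k ≠ 0 → 0 < (xiPairZero b k).re ∧ (xiPairZero b k).re < 1 :=
    fun k hk ↦ re_mem_Ioo_of_xiPair_eq_zero hχ h1 (xiPair_xiPairZero h2 hprod hk)
  have hT1 : ∀ k, b k ≠ 0 → (T 1 k).re = pairing 0 (xiPairZero b k) / 2 := by
    intro k hk
    have h := re_term_eq_pairing_div_two h2 hprod (ε := 0) (by rw [add_zero]; exact hΞne 1 le_rfl) hk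
    rw [add_zero] at h
    rw [hT]; exact h
  have hTφ : ∀ k, b k ≠ 0 → (T φ k).re = pairing (φ - 1) (xiPairZero b k) / 2 := by
    intro k hk
    have e : (1 + (φ - 1) : ℝ) = φ := by ring
    have h := re_term_eq_pairing_div_two h2 hprod (ε := φ - 1) (by rw [e]; exact hΞne φ hφ1.le) hk
    rw [e] at h
    rw [hT]; exact h
  have hT0 : ∀ (σ : ℝ) (k : ℕ), b k = 0 → (T σ k).re = 0 := fun σ k hk ↦ by rw [hT]; simp [hk]
  -- termwise: Lemma 3.4 (i) (`Re T_k(φ) ≤ √5 · Re T_k(1)`), `Re T_k(1) ≥ 0`, `Re T_k(φ) ≤ 2/ε = 1 + √5`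
  have hcmp : ∀ k, (T φ k).re ≤ Real.sqrt 5 * (T 1 k).re := by
    intro k
    by_cases hk : b k = 0
    · rw [hT0 φ k hk, hT0 1 k hk, mul_zero]
    · rw [hT1 k hk, hTφ k hk]
      have h := pairing_zero_gt (xiPairZero b k) (hρ k hk).1 (hρ k hk).2
      rw [← hφ, h2φ, div_lt_iff₀ hs5pos] at h
      linarith
  have hnn1 : ∀ k, 0 ≤ (T 1 k).re := by
    intro k
    by_cases hk : b k = 0
    · rw [hT0 1 k hk]
    · rw [hT1 k hk]
      exact div_nonneg (pairing_nonneg le_rfl (hρ k hk).1 (hρ k hk).2) zero_le_two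
  have hbdφ : ∀ k, (T φ k).re ≤ 1 + Real.sqrt 5 := by
    intro k
    by_cases hk : b k = 0
    · rw [hT0 φ k hk]; linarith
    · rw [hTφ k hk]
      have h := pairing_div_two_le (ε := φ - 1) (by linarith) (hρ k hk).1 (hρ k hk).2
      have e : 2 / (φ - 1) = 2 * φ := by
        rw [div_eq_iff (by linarith : φ - 1 ≠ 0)]; linarith [hεφ]
      linarith
  -- **the selection `𝒮̃`**
  obtain ⟨I, hIb, hIcard, hIsum⟩ := exists_index_finset hχ h1 hbs h2 hmult hprod S w hS
  have hIval : ∑ k ∈ I, (T 1 k).re =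
      ∑ k ∈ I, ((1 / (1 - xiPairZero b k)).re + (1 / xiPairZero b k).re) :=
    Finset.sum_congr rfl fun k hk ↦ by rw [hT1 k (hIb k hk), pairing_zero_div_two]
  have hIcardR : (I.card : ℝ) ≤ 2 * ∑ ρ ∈ S, (w ρ : ℝ) := by exact_mod_cast hIcard
  -- splitting `U(1)` and `U(φ)` along `I`
  have hsplit1 := (hTre 1).sum_add_tsum_subtype_compl I
  have hsplitφ := (hTre φ).sum_add_tsum_subtype_compl I
  beta_reduce at hsplit1 hsplitφ
  have hc1 : Summable fun k : {k // k ∉ I} ↦ (T 1 k).re := (hTre 1).comp_injective Subtype.val_injective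
  have hcφ : Summable fun k : {k // k ∉ I} ↦ (T φ k).re := (hTre φ).comp_injective Subtype.val_injective
  have hcomp : ∑' k : {k // k ∉ I}, (T φ k).re ≤ Real.sqrt 5 * ∑' k : {k // k ∉ I}, (T 1 k).re := by
    rw [← tsum_mul_left]
    exact Summable.tsum_le_tsum (fun k ↦ hcmp k) hcφ (hc1.mul_left _)
  have hfinφ : ∑ k ∈ I, (T φ k).re ≤ I.card * (1 + Real.sqrt 5) := by
    have h := Finset.sum_le_sum fun k (_ : k ∈ I) ↦ hbdφ k
    rwa [Finset.sum_const, nsmul_eq_mul] at h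
  have hprodI : (I.card : ℝ) * (1 + Real.sqrt 5) ≤ (2 * ∑ ρ ∈ S, (w ρ : ℝ)) * (1 + Real.sqrt 5) :=
    mul_le_mul_of_nonneg_right hIcardR (by linarith)
  -- the explicit formulas at `1` and `φ`
  have hU1 := hU 1 le_rfl
  have hUφ := hU φ hφ1.le
  rw [Complex.ofReal_one] at hU1
  -- the `Γ_ℝ` terms: monotone in `σ`, non-positive at `σ = 1` (the constant `G > 0`)
  have hκ1 : (charParity χ : ℝ) ≤ 1 := by
    have : charParity χ ≤ 1 := by unfold charParity; split_ifs <;> norm_num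
    exact_mod_cast this
  have hκ0 : (0 : ℝ) ≤ charParity χ := Nat.cast_nonneg _
  have eκ1 : (1 : ℂ) + (charParity χ : ℂ) = ((1 + charParity χ : ℝ) : ℂ) := by push_cast; ring
  have eκφ : (φ : ℂ) + (charParity χ : ℂ) = ((φ + charParity χ : ℝ) : ℂ) := by push_cast; ring
  have hg_mono : (logDeriv Gammaℝ ((1 : ℂ) + charParity χ)).re ≤
      (logDeriv Gammaℝ ((φ : ℂ) + charParity χ)).re := by
    rw [eκ1, eκφ]; exact re_logDeriv_Gammaℝ_ofReal_mono (by linarith) (by linarith)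
  have hg_nonpos : (logDeriv Gammaℝ ((1 : ℂ) + charParity χ)).re ≤ 0 := by
    rw [eκ1]; exact re_logDeriv_Gammaℝ_ofReal_nonpos (by linarith) (by linarith)
  -- `Re L'/L(φ, χ) ≥ −φ + ½ log π − ½ Re ψ(φ/2 + 1)` and `Re ψ(φ/2 + 1) ≤ 1 − γ`
  have hLφ := re_logDeriv_LFunction_ofReal_ge χ hφ1
  rw [hinvε] at hLφ
  have hψ : (digamma ((φ : ℂ) / 2 + 1)).re ≤ 1 - Real.eulerMascheroniConstant := by
    have e : (φ : ℂ) / 2 + 1 = ((φ / 2 + 1 : ℝ) : ℂ) := by push_cast; ring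
    rw [e]; exact re_digamma_le_one_sub (by linarith) (by linarith)
  have hγ := Real.one_half_lt_eulerMascheroniConstant
  have hπ : 0 < Real.log Real.pi := Real.log_pos (by linarith [Real.pi_gt_three])
  -- scaled facts for the final linear combination
  have hsg : Real.sqrt 5 * (logDeriv Gammaℝ ((1 : ℂ) + charParity χ)).re ≤
      1 * (logDeriv Gammaℝ ((1 : ℂ) + charParity χ)).re :=
    mul_le_mul_of_nonpos_right (by linarith) hg_nonpos
  have hsL : Real.sqrt 5 * (2 * ∑ ρ ∈ S, (w ρ : ℝ) * (1 / (1 - ρ)).re) ≤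
      Real.sqrt 5 * ∑ k ∈ I, (T 1 k).re := by
    rw [hIval]; exact mul_le_mul_of_nonneg_left hIsum hs5pos.le
  have hsA : Real.sqrt 5 * ∑ k ∈ I, (T 1 k).re + Real.sqrt 5 * ∑' k : {k // k ∉ I}, (T 1 k).re =
      Real.sqrt 5 * (Real.log q + 2 * (logDeriv Gammaℝ ((1 : ℂ) + charParity χ)).re +
        2 * (deriv χ.LFunction 1 / χ.LFunction 1).re) := by
    rw [← hU1, ← hsplit1]; ring
  -- conclude: the claim multiplied by `√5 > 0`
  refine lt_of_mul_lt_mul_left ?_ hs5pos.le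
  have eR : Real.sqrt 5 * ((1 - 1 / Real.sqrt 5) / 2 * Real.log q +
        (deriv χ.LFunction 1 / χ.LFunction 1).re +
        (1 + 1 / Real.sqrt 5) * (2 * (∑ ρ ∈ S, (w ρ : ℝ)) + 3) / 2 - 1) =
      (Real.sqrt 5 - 1) / 2 * Real.log q + Real.sqrt 5 * (deriv χ.LFunction 1 / χ.LFunction 1).re +
        (Real.sqrt 5 + 1) * (2 * (∑ ρ ∈ S, (w ρ : ℝ)) + 3) / 2 - Real.sqrt 5 := by
    field_simp
  rw [eR]
  linarith [hsA, hUφ, hsplitφ, hfinφ, hprodI, hcomp, hg_mono, hsg, hLφ, hψ, hγ, hπ, hsL, hφ, h5gt]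

end Tafula2021

/-- **Táfula 2025, Remark 2.3 — PROVED** (discharge of the named fact
`Literature.NumberTheory.LFunctions.tafula2025_remark23` of `LogDerivAtOneQuasiZeroFree.lean`, via
`Tafula2021.tafula2025_remark23_of_proposition31` and the discharge of Proposition 3.1 above; it lives
downstream of its statement file because the proof uses the 2021 paper's Proposition 3.1).
[cite: Tafula2025, Remark 2.3] [cite: Tafula2021, Proposition 3.1] -/
theorem tafula2025_remark23_holds : tafula2025_remark23 :=
  Tafula2021.tafula2025_remark23_of_proposition31 tafula2021_proposition31_holds

namespace Tafula2021

/-- **Unconditional explicit lower bound** (Proposition 3.1 with `𝒮 = ∅`, now a theorem): for every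
primitive `χ` mod `q ≥ 2`, `Re(L'(1,χ)/L(1,χ)) > −(1 − 1/√5)·½·log q − ((1 + 1/√5)·3/2 − 1)`
(`> −0.2764·log q − 1.171`). [cite: Tafula2021, Proposition 3.1 (arXiv p0006:L5–L7)] -/
theorem re_logDeriv_one_gt {q : ℕ} [NeZero q] (hq : 2 ≤ q) (χ : DirichletCharacter ℂ q)
    (hχ : χ.IsPrimitive) :
    -((1 - 1 / Real.sqrt 5) / 2 * Real.log q) - ((1 + 1 / Real.sqrt 5) * 3 / 2 - 1) <
      (deriv χ.LFunction 1 / χ.LFunction 1).re :=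
  neg_logDeriv_one_lt tafula2021_proposition31_holds hq χ hχ

/-- **The explicit one-zero dictionary, unconditionally** (Proposition 3.1 with `𝒮 = {β}`, now a
theorem): a real zero `β ∈ (0,1)` of `L(s,χ)`, `χ` primitive mod `q ≥ 2`, satisfies
`1/(1 − β) < (1 − 1/√5)·½·log q + Re(L'/L(1,χ)) + (1 + 1/√5)·5/2 − 1`.
[cite: Tafula2021, Proposition 3.1 and §3.4 (arXiv p0006:L5–L7, p0008:L15–L19)] -/
theorem one_div_sub_lt' {q : ℕ} [NeZero q] (hq : 2 ≤ q) (χ : DirichletCharacter ℂ q)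
    (hχ : χ.IsPrimitive) {β : ℝ} (hβ0 : 0 < β) (hβ1 : β < 1) (hzero : χ.LFunction β = 0) :
    1 / (1 - β) < (1 - 1 / Real.sqrt 5) / 2 * Real.log q +
      (deriv χ.LFunction 1 / χ.LFunction 1).re + ((1 + 1 / Real.sqrt 5) * 5 / 2 - 1) :=
  one_div_sub_lt tafula2021_proposition31_holds hq χ hχ hβ0 hβ1 hzero


/-! ## Discharge of Proposition 3.2 (`tafula2021_proposition32_holds`)

READ: arXiv:1911.07215 §3.1 Lemma 3.3, Lemma 3.4 (ii) with its proof (chunks p0006:L39–p0007:L58) and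
§3.2, proof of Proposition 3.2 (p0007:L76–L105). The printed proof: with `M = f(q) ≥ 2`,
`ε = (M log q)^{-1/2}`, `ℬ = ℬ_{1/M}`, `ℬ̃ = ℬ ∪ (1 − ℬ)`, write
`Re L'/L(1,χ) − Σ_{Z(χ)∩ℬ} Re 1/(1−ρ) = S₁ − S₂ + S₃`, `S₁ = Σ_{Z∖ℬ̃}(Π₀ − Π_ε)/4`,
`S₂ = Σ_{Z∩ℬ̃} Π_ε/4 − Σ_{Z∩ℬ} Re(1/ρ)`, `S₃ = Σ_Z Π_ε/4 − ½log q + G`; then `|S₁| < 5Mε(log q + 2/ε)/2`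
(Lemma 3.4 (ii) and Lemma 3.3 (i)), `|S₂| < 2|Z∩ℬ|/ε` (`Π_ε/4 < 1/ε`), `|S₃| < 1 + 1/ε`
(Lemma 3.3 (ii)), whence `< (7/2 + 2n)√(M log q) + 5M + 1 ≤ (14.5 + 2n)√(M log q)` using
`M ≤ 4 log q`. Transport (doubled frame, as for Proposition 3.1 above):
* Part A/B — Lemma 3.4 (ii) ↦ `abs_pairing_zero_sub_le` (`|Π₀ − Π_ε| ≤ 5MεΠ_ε` on the cover
  `R₁: t² ≥ 1`, `R₂: 2Mσ(1−σ) ≥ 1`, `R₃: 2Mt² ≥ 1 + t²` of the strip minus `ℬ̃`,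
  `regime_of_not_mem_pageBox`), proved from the closed form `pairing_eq_closedForm` as three
  polynomial inequalities in `x = σ(1−σ)`, `T = t²`, `e = ε(1+ε)` (the key identity
  `(x+T)D_ε = (x+e+T)D₀ + e·W₀`, `W₀ = x² + 6xT + T² − T + e(x+T)`; the final constant `5Mε` is
  proved directly, the source's intermediate `(1+ε²/(1+ε))`, `(1+Mε)` are not needed);
* Part C — Lemma 3.3 two-sided ↦ `abs_re_logDeriv_LFunction_ofReal_lt` (`|Re L'/L(σ,χ)| ≤ −ζ'/ζ(σ) <
  1/(σ−1)`, `1 < σ ≤ 2`), `re_logDeriv_Gammaℝ_ofReal_sub_le_one` (`½[ψ(y/2) − ψ(x/2)] ≤ 1` for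
  `1 ≤ x ≤ y ≤ x+2`, from `ψ(s+1) = ψ(s) + 1/s` — no numerics), `Re Γ_ℝ'/Γ_ℝ(x) ≤ 0` for `x ≤ 4`;
* Part D — `Z(χ) ∩ ℬ̃` ↦ `exists_boxed_index_finsets`: the live indices whose pair meets `ℬ` split as
  `I₀` (`ρ_k ∈ ℬ`) and `I₁` (`1 − ρ_k ∈ ℬ`), `|I₀| + |I₁| = 2n`, boxed halves `= 2Σ m Re 1/(1−ρ)`
  (full fibres, `ncard_index_add_ncard_index_eq`), all other live pairs avoid `ℬ̃`;
* Part E — assembly ↦ `abs_re_logDeriv_sub_pageBox_lt` (the engine, every `M ≥ 2`: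
  `< (7/2 + 2n)√(M log q) + 5M + 1`) and its corollary `tafula2021_proposition32_holds`
  (`M ≤ 4 log q`): `2(Re L'/L(1) − Σ m Re 1/(1−ρ)) =
  rest₁ + O − log q − 2g(1+κ)` with `rest_σ = Σ_{k∉I} Re T_k(σ)`, `O ∈ [0, 4n]` the free halves,
  `(1−5Mε)rest_φ ≤ rest₁ ≤ (1+5Mε)rest_φ`, `rest_φ ≤ U(φ) < log q + 2/ε`, `Σ_I Re T_k(φ) ≤ 4n/ε`.
-/

open DirichletTheta

variable {q : ℕ} [NeZero q] {χ : DirichletCharacter ℂ q} {b : ℕ → ℂ}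



/-- R₂ (`2Mx ≥ 1`): `2W₀ ≤ 5M(x+e+T)D₀` (Step 2, upper). [cite: Tafula2021, Lemma 3.4 (ii), proof Step 2 (arXiv p0007:L22–L45)] -/
private theorem two_W_le_R2 {x T e M : ℝ} (hx0 : 0 < x) (hx4 : x ≤ 1 / 4) (hT : 0 ≤ T) (he0 : 0 ≤ e)
    (hM : 2 ≤ M) (h : 1 ≤ 2 * M * x) :
    2 * (x ^ 2 + 6 * x * T + T ^ 2 - T + e * (x + T)) ≤
      5 * M * (x + e + T) * (x ^ 2 + (1 - 2 * x) * T + T ^ 2) := by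
  have hD0 : 0 ≤ x ^ 2 + (1 - 2 * x) * T + T ^ 2 := by
    have : 0 ≤ (1 - 2 * x) * T := mul_nonneg (by linarith) hT
    positivity
  have hM0 : 0 ≤ M := by linarith
  -- split `5M(x+e+T)D₀ = 5Mx D₀ + 5Me D₀ + 5MT D₀`
  have h1 : 5 * M * x * (x ^ 2 + (1 - 2 * x) * T + T ^ 2) ≥
      5 / 2 * (x ^ 2 + (1 - 2 * x) * T + T ^ 2) := by
    have := mul_nonneg (by linarith : 0 ≤ 2 * M * x - 1) hD0
    nlinarith
  have h2 : 0 ≤ 5 * M * T * (x ^ 2 + (1 - 2 * x) * T + T ^ 2) := by positivity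
  have h3a : 5 * M * e * x ^ 2 ≥ 5 / 2 * (e * x) := by
    have := mul_nonneg (by linarith : 0 ≤ 2 * M * x - 1) (mul_nonneg he0 hx0.le)
    nlinarith
  have h3b : 5 * M * e * ((1 - 2 * x) * T) ≥ 5 * (e * T) := by
    have h12 : (1 : ℝ) / 2 ≤ 1 - 2 * x := by linarith
    have heT : 0 ≤ e * T := mul_nonneg he0 hT
    have : 5 * M * e * ((1 - 2 * x) * T) = 5 * M * (1 - 2 * x) * (e * T) := by ring
    rw [this]
    have : 5 * M * (1 - 2 * x) ≥ 5 := by nlinarith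
    nlinarith
  have h3c : 0 ≤ 5 * M * e * T ^ 2 := by positivity
  have hxT : 17 * x * T ≤ 17 / 4 * T := by nlinarith
  have hexT : 0 ≤ e * x := mul_nonneg he0 hx0.le
  nlinarith [h1, h2, h3a, h3b, h3c, hxT, sq_nonneg x, sq_nonneg T, mul_nonneg he0 hT]

/-- R₃ (`2MT ≥ 1 + T`): `2W₀ ≤ 5M(x+e+T)D₀` (Step 2, upper). [cite: Tafula2021, Lemma 3.4 (ii), proof Step 2 (arXiv p0007:L22–L45)] -/
private theorem two_W_le_R3 {x T e M : ℝ} (hx0 : 0 < x) (hx4 : x ≤ 1 / 4) (hT : 0 ≤ T) (he0 : 0 ≤ e)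
    (hM : 2 ≤ M) (h : 1 + T ≤ 2 * M * T) :
    2 * (x ^ 2 + 6 * x * T + T ^ 2 - T + e * (x + T)) ≤
      5 * M * (x + e + T) * (x ^ 2 + (1 - 2 * x) * T + T ^ 2) := by
  have hD0 : 0 ≤ x ^ 2 + (1 - 2 * x) * T + T ^ 2 := by
    have : 0 ≤ (1 - 2 * x) * T := mul_nonneg (by linarith) hT
    positivity
  have hM0 : 0 ≤ M := by linarith
  have h1 : 5 * M * T * (x ^ 2 + (1 - 2 * x) * T + T ^ 2) ≥
      5 / 2 * (x ^ 2 + (1 - 2 * x) * T + T ^ 2) := by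
    have := mul_nonneg (by linarith : 0 ≤ 2 * M * T - 1 - T) hD0
    nlinarith
  have h2 : 0 ≤ 5 * M * x * (x ^ 2 + (1 - 2 * x) * T + T ^ 2) := by positivity
  -- `5Me D₀ ≥ 5Me(T/2 + T²) = 2.5 MeT + 5MeT²`, `MT ≥ (1+T)/2`
  have h3a : 5 * M * e * ((1 - 2 * x) * T) ≥ 5 / 2 * M * (e * T) := by
    have heT : 0 ≤ e * T := mul_nonneg he0 hT
    have : 0 ≤ M * (e * T) := mul_nonneg hM0 heT
    nlinarith
  have h3b : 5 / 2 * M * (e * T) ≥ 5 / 4 * e * (1 + T) := by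
    have := mul_nonneg (by linarith : 0 ≤ 2 * M * T - 1 - T) he0
    nlinarith
  have h3c : 5 * M * e * T ^ 2 ≥ 5 / 2 * (e * T) := by
    have := mul_nonneg (by linarith : 0 ≤ 2 * M * T - 1 - T) (mul_nonneg he0 hT)
    nlinarith
  have h3d : 0 ≤ 5 * M * e * x ^ 2 := by positivity
  have hxT : 17 * x * T ≤ 17 / 4 * T := by nlinarith
  have hex : 2 * (e * x) ≤ 1 / 2 * e := by nlinarith
  nlinarith [h1, h2, h3a, h3b, h3c, h3d, hxT, hex, sq_nonneg x, sq_nonneg T, mul_nonneg he0 hT]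

/-- R₁ (`T ≥ 1`): `2W₀ ≤ 5M(x+e+T)D₀` (Step 1, upper). [cite: Tafula2021, Lemma 3.4 (ii), proof Step 1 (arXiv p0006:L59–p0007:L21)] -/
private theorem two_W_le_R1 {x T e M : ℝ} (hx0 : 0 < x) (hx4 : x ≤ 1 / 4) (he0 : 0 ≤ e)
    (he2 : e ≤ 2) (hM : 2 ≤ M) (h : 1 ≤ T) :
    2 * (x ^ 2 + 6 * x * T + T ^ 2 - T + e * (x + T)) ≤
      5 * M * (x + e + T) * (x ^ 2 + (1 - 2 * x) * T + T ^ 2) := by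
  have hT : 0 ≤ T := by linarith
  have hD0 : 0 ≤ x ^ 2 + (1 - 2 * x) * T + T ^ 2 := by
    have : 0 ≤ (1 - 2 * x) * T := mul_nonneg (by linarith) hT
    positivity
  -- `5M(x+e+T)D₀ ≥ 10 T D₀ ≥ 10T(T/2 + T²) ≥ 15T²`
  have h1 : 5 * M * (x + e + T) * (x ^ 2 + (1 - 2 * x) * T + T ^ 2) ≥
      10 * T * (x ^ 2 + (1 - 2 * x) * T + T ^ 2) := by
    have hxeT : T ≤ x + e + T := by linarith
    have := mul_le_mul (by linarith : 10 ≤ 5 * M) hxeT hT (by linarith)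
    have := mul_le_mul_of_nonneg_right this hD0
    linarith
  have h2 : 10 * T * (x ^ 2 + (1 - 2 * x) * T + T ^ 2) ≥ 15 * T ^ 2 := by
    have hT2 : T ^ 2 ≤ T ^ 3 := by nlinarith
    have : (1 - 2 * x) * T ≥ T / 2 := by nlinarith
    nlinarith [sq_nonneg x]
  -- `2W₀ ≤ 8.125 T²`
  have hTT : T ≤ T ^ 2 := by nlinarith
  have h1T : 1 ≤ T ^ 2 := by nlinarith
  have h3 : 2 * (x ^ 2 + 6 * x * T + T ^ 2 - T + e * (x + T)) ≤ 33 / 4 * T ^ 2 := by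
    have hx2 : x ^ 2 ≤ 1 / 16 := by nlinarith
    have hxT : 6 * x * T ≤ 3 / 2 * T := by nlinarith
    have hex : e * (x + T) ≤ 2 * (1 / 4 + T) := by nlinarith
    nlinarith
  linarith

/-- Lower bound, R₂/R₃ (`g = 2Mε(1+ε)`): `W₀ + 2M(x+T)D_ε ≥ 0` (Step 2, lower). [cite: Tafula2021, Lemma 3.4 (ii), proof Step 2 (arXiv p0007:L22–L45)] -/
private theorem lower_R23 {x T e M : ℝ} (hx0 : 0 < x) (hx4 : x ≤ 1 / 4) (hT : 0 ≤ T) (he0 : 0 ≤ e)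
    (hM : 2 ≤ M) (h : 1 ≤ 2 * M * x ∨ 1 + T ≤ 2 * M * T) :
    0 ≤ x ^ 2 + 6 * x * T + T ^ 2 - T + e * (x + T) +
      2 * M * (x + T) * (x ^ 2 + (1 - 2 * x) * T + T ^ 2 + e * (2 * x + e + 2 * T)) := by
  have hDe : (1 - 2 * x) * T + T ^ 2 ≤
      x ^ 2 + (1 - 2 * x) * T + T ^ 2 + e * (2 * x + e + 2 * T) := by
    have : 0 ≤ e * (2 * x + e + 2 * T) := by positivity
    nlinarith
  have hDe0 : 0 ≤ x ^ 2 + (1 - 2 * x) * T + T ^ 2 + e * (2 * x + e + 2 * T) := by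
    have : 0 ≤ (1 - 2 * x) * T := mul_nonneg (by linarith) hT
    linarith [sq_nonneg T]
  have hM0 : 0 ≤ M := by linarith
  -- `2M(x+T) D_e ≥ D_e`
  have hkey : x ^ 2 + (1 - 2 * x) * T + T ^ 2 + e * (2 * x + e + 2 * T) ≤
      2 * M * (x + T) * (x ^ 2 + (1 - 2 * x) * T + T ^ 2 + e * (2 * x + e + 2 * T)) := by
    have h1 : 1 ≤ 2 * M * (x + T) := by
      rcases h with h | h
      · nlinarith
      · nlinarith
    have := mul_le_mul_of_nonneg_right h1 hDe0
    linarith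
  have hexT : 0 ≤ e * (x + T) := by positivity
  nlinarith [sq_nonneg x]

/-- Lower bound, R₁ (`g = 0`): `W₀ ≥ 0` (Step 1, lower). [cite: Tafula2021, Lemma 3.4 (ii), proof Step 1 (arXiv p0006:L59–p0007:L21)] -/
private theorem lower_R1 {x T e : ℝ} (hx0 : 0 < x) (he0 : 0 ≤ e) (h : 1 ≤ T) :
    0 ≤ x ^ 2 + 6 * x * T + T ^ 2 - T + e * (x + T) := by
  have hT : 0 ≤ T := by linarith
  have : 0 ≤ e * (x + T) := by positivity
  nlinarith

/-- `(1 − 5Mε)(1+2ε)(1+2Mε(1+ε)) ≤ 1` for `M ≥ 2`, `0 < ε`, `5Mε ≤ 1` (Step 3: «`1 − ((1+2ε)(1+g))⁻¹ < 2Mε(M⁻¹ + 1 + ε)` … `< 5Mε`»). [cite: Tafula2021, Lemma 3.4 (ii), proof Step 3 (arXiv p0007:L46–L58)] -/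
private theorem one_sub_mul_le {M ε : ℝ} (hM : 2 ≤ M) (hε0 : 0 < ε) (h5 : 5 * M * ε ≤ 1) :
    (1 - 5 * M * ε) * ((1 + 2 * ε) * (1 + 2 * M * (ε * (1 + ε)))) ≤ 1 := by
  have hε1 : ε ≤ 1 / 10 := by nlinarith
  have hu0 : 0 ≤ M * ε := by nlinarith
  -- `(1+ε)(1+2ε) ≤ 2`, so `(1+2ε)(1+2Mε(1+ε)) ≤ 1 + 2ε + 4Mε ≤ 1 + 5Mε`
  have hA : (1 + 2 * ε) * (1 + 2 * M * (ε * (1 + ε))) ≤ 1 + 5 * M * ε := by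
    have h12 : (1 + ε) * (1 + 2 * ε) ≤ 2 := by nlinarith
    have : (1 + 2 * ε) * (1 + 2 * M * (ε * (1 + ε))) =
        1 + 2 * ε + 2 * (M * ε) * ((1 + ε) * (1 + 2 * ε)) := by ring
    rw [this]
    nlinarith
  have hpos : 0 ≤ 1 - 5 * M * ε := by linarith
  calc (1 - 5 * M * ε) * ((1 + 2 * ε) * (1 + 2 * M * (ε * (1 + ε))))
      ≤ (1 - 5 * M * ε) * (1 + 5 * M * ε) := mul_le_mul_of_nonneg_left hA hpos
    _ = 1 - (5 * M * ε) ^ 2 := by ring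
    _ ≤ 1 := by nlinarith [sq_nonneg (5 * M * ε)]



/-- Closed form of `Π₀`: `Π₀(s) = 2(x+T)/(x² + (1−2x)T + T²)`, `x = σ(1−σ)`, `T = t²` (the first
display of the proof of Lemma 3.4 at `ε = 0`). [cite: Tafula2021, Lemma 3.4, proof, first display (arXiv p0006:L50–L52)] -/
theorem pairing_zero_eq {s : ℂ} (h0 : 0 < s.re) (h1 : s.re < 1) :
    pairing 0 s = 2 * (s.re * (1 - s.re) + s.im ^ 2) /
      ((s.re * (1 - s.re)) ^ 2 + (1 - 2 * (s.re * (1 - s.re))) * s.im ^ 2 + (s.im ^ 2) ^ 2) := by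
  have hd01 : (s.re + 0) ^ 2 + s.im ^ 2 ≠ 0 := by
    have : 0 < (s.re + 0) ^ 2 := by rw [add_zero]; exact pow_pos h0 2
    positivity
  have hd02 : (1 - s.re + 0) ^ 2 + s.im ^ 2 ≠ 0 := by
    have : 0 < (1 - s.re + 0) ^ 2 := by rw [add_zero]; exact pow_pos (by linarith) 2
    positivity
  have h := pairing_eq_closedForm 0 s hd01 hd02
  rw [show (1 + 2 * (0 : ℝ)) * (s.re * (1 - s.re) + 0 * (1 + 0) + s.im ^ 2) =
      s.re * (1 - s.re) + s.im ^ 2 by ring,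
    show (s.re * (1 - s.re) + 0 * (1 + 0)) ^ 2 +
        ((1 + 2 * (0 : ℝ)) ^ 2 - 2 * (s.re * (1 - s.re) + 0 * (1 + 0))) * s.im ^ 2 + (s.im ^ 2) ^ 2 =
      (s.re * (1 - s.re)) ^ 2 + (1 - 2 * (s.re * (1 - s.re))) * s.im ^ 2 + (s.im ^ 2) ^ 2 by ring] at h
  rw [mul_div_assoc]; linarith

/-- Closed form of `Π_ε` (`ε ≥ 0`): `Π_ε(s) = 2(1+2ε)(x+e+T)/(x² + (1−2x)T + T² + e(2x + e + 2T))`,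
`e = ε(1+ε)` (the first display of the proof of Lemma 3.4, denominator expanded as in Step 1:
`σ̃² + (1−2σ̃)t² + t⁴ + ε(1+ε)(2σ̃ + ε(1+ε) + 2t²)`).
[cite: Tafula2021, Lemma 3.4, proof, first display and Step 1 (arXiv p0006:L50–L52, p0007:L1–L5)] -/
theorem pairing_eq' {ε : ℝ} (hε : 0 ≤ ε) {s : ℂ} (h0 : 0 < s.re) (h1 : s.re < 1) :
    pairing ε s = 2 * ((1 + 2 * ε) * (s.re * (1 - s.re) + ε * (1 + ε) + s.im ^ 2)) /
      ((s.re * (1 - s.re)) ^ 2 + (1 - 2 * (s.re * (1 - s.re))) * s.im ^ 2 + (s.im ^ 2) ^ 2 +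
        ε * (1 + ε) * (2 * (s.re * (1 - s.re)) + ε * (1 + ε) + 2 * s.im ^ 2)) := by
  have hdε1 : (s.re + ε) ^ 2 + s.im ^ 2 ≠ 0 := by
    have : 0 < (s.re + ε) ^ 2 := pow_pos (by linarith) 2
    positivity
  have hdε2 : (1 - s.re + ε) ^ 2 + s.im ^ 2 ≠ 0 := by
    have : 0 < (1 - s.re + ε) ^ 2 := pow_pos (by linarith) 2
    positivity
  have h := pairing_eq_closedForm ε s hdε1 hdε2
  rw [show (s.re * (1 - s.re) + ε * (1 + ε)) ^ 2 +
      ((1 + 2 * ε) ^ 2 - 2 * (s.re * (1 - s.re) + ε * (1 + ε))) * s.im ^ 2 + (s.im ^ 2) ^ 2 =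
      (s.re * (1 - s.re)) ^ 2 + (1 - 2 * (s.re * (1 - s.re))) * s.im ^ 2 + (s.im ^ 2) ^ 2 +
        ε * (1 + ε) * (2 * (s.re * (1 - s.re)) + ε * (1 + ε) + 2 * s.im ^ 2) by ring] at h
  rw [mul_div_assoc]; linarith

/-- Lemma 3.4 (ii), upper half: `Π₀ ≤ (1 + 5Mε) Π_ε` on `R₁ ∪ R₂ ∪ R₃`.
[cite: Tafula2021, Lemma 3.4 (ii) (arXiv p0006:L45–L47; proof Steps 1–3, p0006:L59–p0007:L58)] -/
theorem pairing_zero_le_mul {M ε : ℝ} (hM : 2 ≤ M) (hε0 : 0 < ε) (hε1 : ε < 1) {s : ℂ}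
    (h0 : 0 < s.re) (h1 : s.re < 1)
    (hreg : 1 ≤ s.im ^ 2 ∨ (1 ≤ 2 * M * (s.re * (1 - s.re)) ∨ 1 + s.im ^ 2 ≤ 2 * M * s.im ^ 2)) :
    pairing 0 s ≤ (1 + 5 * M * ε) * pairing ε s := by
  rw [pairing_zero_eq h0 h1, pairing_eq' hε0.le h0 h1]
  have hxle : s.re * (1 - s.re) ≤ 1 / 4 := by nlinarith [sq_nonneg (s.re - 1 / 2)]
  have hxpos : 0 < s.re * (1 - s.re) := mul_pos h0 (by linarith)
  obtain ⟨x, hx⟩ : ∃ x : ℝ, s.re * (1 - s.re) = x := ⟨_, rfl⟩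
  obtain ⟨T, hT⟩ : ∃ T : ℝ, s.im ^ 2 = T := ⟨_, rfl⟩
  rw [hx, hT] at hreg ⊢
  rw [hx] at hxle hxpos
  have hT0 : 0 ≤ T := by rw [← hT]; positivity
  have he0 : 0 ≤ ε * (1 + ε) := by positivity
  have he2 : ε * (1 + ε) ≤ 2 := by nlinarith
  have hM0 : 0 ≤ M := by linarith
  have hD₀pos : 0 < x ^ 2 + (1 - 2 * x) * T + T ^ 2 := by
    have : 0 ≤ (1 - 2 * x) * T := mul_nonneg (by linarith) hT0
    positivity
  have hDεpos : 0 < x ^ 2 + (1 - 2 * x) * T + T ^ 2 + ε * (1 + ε) * (2 * x + ε * (1 + ε) + 2 * T) := by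
    have : 0 ≤ ε * (1 + ε) * (2 * x + ε * (1 + ε) + 2 * T) := by positivity
    linarith
  have hkey : (x + T) * (x ^ 2 + (1 - 2 * x) * T + T ^ 2 + ε * (1 + ε) * (2 * x + ε * (1 + ε) + 2 * T)) =
      (x + ε * (1 + ε) + T) * (x ^ 2 + (1 - 2 * x) * T + T ^ 2) +
        ε * (1 + ε) * (x ^ 2 + 6 * x * T + T ^ 2 - T + ε * (1 + ε) * (x + T)) := by ring
  have hA'D₀ : 0 ≤ (x + ε * (1 + ε) + T) * (x ^ 2 + (1 - 2 * x) * T + T ^ 2) := by positivity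
  -- `e W₀ ≤ 5Mε (x+e+T) D₀`
  have hW : ε * (1 + ε) * (x ^ 2 + 6 * x * T + T ^ 2 - T + ε * (1 + ε) * (x + T)) ≤
      5 * M * ε * ((x + ε * (1 + ε) + T) * (x ^ 2 + (1 - 2 * x) * T + T ^ 2)) := by
    by_cases hW0 : x ^ 2 + 6 * x * T + T ^ 2 - T + ε * (1 + ε) * (x + T) ≤ 0
    · have : ε * (1 + ε) * (x ^ 2 + 6 * x * T + T ^ 2 - T + ε * (1 + ε) * (x + T)) ≤ 0 :=
        mul_nonpos_of_nonneg_of_nonpos he0 hW0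
      have : 0 ≤ 5 * M * ε * ((x + ε * (1 + ε) + T) * (x ^ 2 + (1 - 2 * x) * T + T ^ 2)) := by
        positivity
      linarith
    · have hW0 : 0 < x ^ 2 + 6 * x * T + T ^ 2 - T + ε * (1 + ε) * (x + T) := lt_of_not_ge hW0
      have h2W : 2 * (x ^ 2 + 6 * x * T + T ^ 2 - T + ε * (1 + ε) * (x + T)) ≤
          5 * M * (x + ε * (1 + ε) + T) * (x ^ 2 + (1 - 2 * x) * T + T ^ 2) := by
        rcases hreg with h | h | h
        · exact two_W_le_R1 hxpos hxle he0 he2 hM h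
        · exact two_W_le_R2 hxpos hxle hT0 he0 hM h
        · exact two_W_le_R3 hxpos hxle hT0 he0 hM h
      have h1e : ε * (1 + ε) ≤ ε * 2 := by nlinarith
      calc ε * (1 + ε) * (x ^ 2 + 6 * x * T + T ^ 2 - T + ε * (1 + ε) * (x + T))
          ≤ ε * 2 * (x ^ 2 + 6 * x * T + T ^ 2 - T + ε * (1 + ε) * (x + T)) :=
            mul_le_mul_of_nonneg_right h1e hW0.le
        _ = ε * (2 * (x ^ 2 + 6 * x * T + T ^ 2 - T + ε * (1 + ε) * (x + T))) := by ring
        _ ≤ ε * (5 * M * (x + ε * (1 + ε) + T) * (x ^ 2 + (1 - 2 * x) * T + T ^ 2)) :=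
            mul_le_mul_of_nonneg_left h2W hε0.le
        _ = 5 * M * ε * ((x + ε * (1 + ε) + T) * (x ^ 2 + (1 - 2 * x) * T + T ^ 2)) := by ring
  -- `(1+5Mε)(x+e+T)D₀ ≤ (1+5Mε)(1+2ε)(x+e+T)D₀`
  have hc1 : (1 + 5 * M * ε) * ((x + ε * (1 + ε) + T) * (x ^ 2 + (1 - 2 * x) * T + T ^ 2)) ≤
      (1 + 5 * M * ε) * (1 + 2 * ε) * ((x + ε * (1 + ε) + T) * (x ^ 2 + (1 - 2 * x) * T + T ^ 2)) := by
    have : 0 ≤ (1 + 5 * M * ε) * (2 * ε) *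
        ((x + ε * (1 + ε) + T) * (x ^ 2 + (1 - 2 * x) * T + T ^ 2)) := by positivity
    linarith
  rw [← mul_div_assoc, div_le_div_iff₀ hD₀pos hDεpos]
  have e1 : (1 + 5 * M * ε) * (2 * ((1 + 2 * ε) * (x + ε * (1 + ε) + T))) *
      (x ^ 2 + (1 - 2 * x) * T + T ^ 2) =
      2 * ((1 + 5 * M * ε) * (1 + 2 * ε) *
        ((x + ε * (1 + ε) + T) * (x ^ 2 + (1 - 2 * x) * T + T ^ 2))) := by ring
  have e2 : 2 * (x + T) * (x ^ 2 + (1 - 2 * x) * T + T ^ 2 +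
      ε * (1 + ε) * (2 * x + ε * (1 + ε) + 2 * T)) =
      2 * ((x + T) * (x ^ 2 + (1 - 2 * x) * T + T ^ 2 +
        ε * (1 + ε) * (2 * x + ε * (1 + ε) + 2 * T))) := by ring
  rw [e1, e2, hkey]
  linarith [hW, hc1]

/-- Lemma 3.4 (ii), lower half: `(1 − 5Mε) Π_ε ≤ Π₀` on `R₁ ∪ R₂ ∪ R₃`.
[cite: Tafula2021, Lemma 3.4 (ii) (arXiv p0006:L45–L47; proof Steps 1–3, p0006:L59–p0007:L58)] -/
theorem mul_pairing_le_pairing_zero {M ε : ℝ} (hM : 2 ≤ M) (hε0 : 0 < ε) {s : ℂ}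
    (h0 : 0 < s.re) (h1 : s.re < 1)
    (hreg : 1 ≤ s.im ^ 2 ∨ (1 ≤ 2 * M * (s.re * (1 - s.re)) ∨ 1 + s.im ^ 2 ≤ 2 * M * s.im ^ 2)) :
    (1 - 5 * M * ε) * pairing ε s ≤ pairing 0 s := by
  by_cases h5 : 1 ≤ 5 * M * ε
  · have : (1 - 5 * M * ε) * pairing ε s ≤ 0 :=
      mul_nonpos_of_nonpos_of_nonneg (by linarith) (pairing_nonneg hε0.le h0 h1)
    have : 0 ≤ pairing 0 s := pairing_nonneg le_rfl h0 h1
    linarith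
  have h5 : 5 * M * ε < 1 := lt_of_not_ge h5
  have h5' : 0 ≤ 1 - 5 * M * ε := by linarith
  rw [pairing_zero_eq h0 h1, pairing_eq' hε0.le h0 h1]
  have hxle : s.re * (1 - s.re) ≤ 1 / 4 := by nlinarith [sq_nonneg (s.re - 1 / 2)]
  have hxpos : 0 < s.re * (1 - s.re) := mul_pos h0 (by linarith)
  obtain ⟨x, hx⟩ : ∃ x : ℝ, s.re * (1 - s.re) = x := ⟨_, rfl⟩
  obtain ⟨T, hT⟩ : ∃ T : ℝ, s.im ^ 2 = T := ⟨_, rfl⟩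
  rw [hx, hT] at hreg ⊢
  rw [hx] at hxle hxpos
  have hT0 : 0 ≤ T := by rw [← hT]; positivity
  have he0 : 0 ≤ ε * (1 + ε) := by positivity
  have hM0 : 0 ≤ M := by linarith
  have hMε : 0 ≤ 5 * M * ε := by positivity
  have hD₀pos : 0 < x ^ 2 + (1 - 2 * x) * T + T ^ 2 := by
    have : 0 ≤ (1 - 2 * x) * T := mul_nonneg (by linarith) hT0
    positivity
  have hDεpos : 0 < x ^ 2 + (1 - 2 * x) * T + T ^ 2 + ε * (1 + ε) * (2 * x + ε * (1 + ε) + 2 * T) := by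
    have : 0 ≤ ε * (1 + ε) * (2 * x + ε * (1 + ε) + 2 * T) := by positivity
    linarith
  have hkey : (x + T) * (x ^ 2 + (1 - 2 * x) * T + T ^ 2 + ε * (1 + ε) * (2 * x + ε * (1 + ε) + 2 * T)) =
      (x + ε * (1 + ε) + T) * (x ^ 2 + (1 - 2 * x) * T + T ^ 2) +
        ε * (1 + ε) * (x ^ 2 + 6 * x * T + T ^ 2 - T + ε * (1 + ε) * (x + T)) := by ring
  have hADε : 0 ≤ (x + T) * (x ^ 2 + (1 - 2 * x) * T + T ^ 2 +
      ε * (1 + ε) * (2 * x + ε * (1 + ε) + 2 * T)) := by positivity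
  have hA'D₀ : 0 ≤ (x + ε * (1 + ε) + T) * (x ^ 2 + (1 - 2 * x) * T + T ^ 2) := by positivity
  rw [← mul_div_assoc, div_le_div_iff₀ hDεpos hD₀pos]
  have e1 : (1 - 5 * M * ε) * (2 * ((1 + 2 * ε) * (x + ε * (1 + ε) + T))) *
      (x ^ 2 + (1 - 2 * x) * T + T ^ 2) =
      2 * ((1 - 5 * M * ε) * (1 + 2 * ε) *
        ((x + ε * (1 + ε) + T) * (x ^ 2 + (1 - 2 * x) * T + T ^ 2))) := by ring
  have e2 : 2 * (x + T) * (x ^ 2 + (1 - 2 * x) * T + T ^ 2 +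
      ε * (1 + ε) * (2 * x + ε * (1 + ε) + 2 * T)) =
      2 * ((x + T) * (x ^ 2 + (1 - 2 * x) * T + T ^ 2 +
        ε * (1 + ε) * (2 * x + ε * (1 + ε) + 2 * T))) := by ring
  rw [e1, e2]
  have h2ε : 2 * ε ≤ 5 * M * ε := by
    have := mul_le_mul_of_nonneg_right (by linarith : (2 : ℝ) ≤ 5 * M) hε0.le
    linarith
  rcases hreg with h | h
  · -- R₁: `g = 0`
    have hW0 : 0 ≤ ε * (1 + ε) * (x ^ 2 + 6 * x * T + T ^ 2 - T + ε * (1 + ε) * (x + T)) :=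
      mul_nonneg he0 (lower_R1 hxpos he0 h)
    have hc : (1 - 5 * M * ε) * (1 + 2 * ε) ≤ 1 := by
      have hp : 0 ≤ 5 * M * ε * (2 * ε) := by positivity
      have e : (1 - 5 * M * ε) * (1 + 2 * ε) = 1 - ((5 * M * ε - 2 * ε) + 5 * M * ε * (2 * ε)) := by
        ring
      rw [e]; linarith
    have hc' := mul_le_mul_of_nonneg_right hc hA'D₀
    linarith [hkey, hW0, hc']
  · -- R₂ ∪ R₃: `g = 2Me`
    have hL := lower_R23 hxpos hxle hT0 he0 hM h
    have hc : (1 - 5 * M * ε) * ((1 + 2 * ε) * (1 + 2 * M * (ε * (1 + ε)))) ≤ 1 :=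
      one_sub_mul_le hM hε0 h5.le
    have hstep : (x + ε * (1 + ε) + T) * (x ^ 2 + (1 - 2 * x) * T + T ^ 2) ≤
        (1 + 2 * M * (ε * (1 + ε))) * ((x + T) * (x ^ 2 + (1 - 2 * x) * T + T ^ 2 +
          ε * (1 + ε) * (2 * x + ε * (1 + ε) + 2 * T))) := by
      have h' := mul_nonneg he0 hL
      have e3 : (1 + 2 * M * (ε * (1 + ε))) * ((x + T) * (x ^ 2 + (1 - 2 * x) * T + T ^ 2 +
          ε * (1 + ε) * (2 * x + ε * (1 + ε) + 2 * T))) -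
          (x + ε * (1 + ε) + T) * (x ^ 2 + (1 - 2 * x) * T + T ^ 2) =
          ε * (1 + ε) * (x ^ 2 + 6 * x * T + T ^ 2 - T + ε * (1 + ε) * (x + T) +
            2 * M * (x + T) * (x ^ 2 + (1 - 2 * x) * T + T ^ 2 +
              ε * (1 + ε) * (2 * x + ε * (1 + ε) + 2 * T))) := by ring
      linarith [e3, h']
    have hcc : 0 ≤ (1 - 5 * M * ε) * (1 + 2 * ε) := by positivity
    have hm1 := mul_le_mul_of_nonneg_left hstep hcc
    have hm2 := mul_le_mul_of_nonneg_right hc hADε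
    have e4 : (1 - 5 * M * ε) * (1 + 2 * ε) * ((1 + 2 * M * (ε * (1 + ε))) *
        ((x + T) * (x ^ 2 + (1 - 2 * x) * T + T ^ 2 +
          ε * (1 + ε) * (2 * x + ε * (1 + ε) + 2 * T)))) =
        (1 - 5 * M * ε) * ((1 + 2 * ε) * (1 + 2 * M * (ε * (1 + ε)))) *
          ((x + T) * (x ^ 2 + (1 - 2 * x) * T + T ^ 2 +
            ε * (1 + ε) * (2 * x + ε * (1 + ε) + 2 * T))) := by ring
    rw [e4] at hm1
    linarith [hm1, hm2]

/-- **Táfula 2021, Lemma 3.4 (ii)** (PROVED, in the closed regimes used by the proof): for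
`0 < Re s < 1`, `M ≥ 2`, `0 < ε < 1` and `s ∈ R₁ ∪ R₂ ∪ R₃` (`t² ≥ 1`, or `2Mσ(1−σ) ≥ 1`, or
`2Mt² ≥ 1 + t²` — a cover of the strip minus `ℬ̃ = ℬ_{1/M} ∪ (1 − ℬ_{1/M})`):
`|Π₀(s) − Π_ε(s)| ≤ 5Mε·Π_ε(s)` («`|Π₀(s) − Π_ε(s)| < 5Mε Π_ε(s)`»).
[cite: Tafula2021, Lemma 3.4 (ii) (arXiv p0006:L45–L47; proof p0006:L59–p0007:L58)] -/
theorem abs_pairing_zero_sub_le {M ε : ℝ} (hM : 2 ≤ M) (hε0 : 0 < ε) (hε1 : ε < 1) {s : ℂ}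
    (h0 : 0 < s.re) (h1 : s.re < 1)
    (hreg : 1 ≤ s.im ^ 2 ∨ (1 ≤ 2 * M * (s.re * (1 - s.re)) ∨ 1 + s.im ^ 2 ≤ 2 * M * s.im ^ 2)) :
    |pairing 0 s - pairing ε s| ≤ 5 * M * ε * pairing ε s := by
  have hu := pairing_zero_le_mul hM hε0 hε1 h0 h1 hreg
  have hl := mul_pairing_le_pairing_zero hM hε0 h0 h1 hreg
  rw [abs_le]
  constructor <;> linarith


/-! ### Part C: the two-sided Lemma 3.3 inputs -/


/-- `log π > 1/2` (`π > 2`, `log 2 > 0.69`). [folklore] -/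
private theorem half_lt_log_pi : (1 : ℝ) / 2 < Real.log Real.pi := by
  have h2 : Real.log 2 ≤ Real.log Real.pi :=
    Real.log_le_log two_pos (by linarith [Real.pi_gt_three])
  linarith [Real.log_two_gt_d9]

/-- **Lemma 3.3's analytic input, two-sided.** For real `σ > 1`:
`|Re L'/L(σ, χ)| ≤ −ζ'/ζ(σ) ≤ 1/(σ−1) − ½ log π + ½ Re ψ(σ/2 + 1)`.
[cite: Tafula2021, Lemma 3.3 (proof, arXiv p0006:L44–L47)] -/
theorem abs_re_logDeriv_LFunction_ofReal_le (χ : DirichletCharacter ℂ q) {σ : ℝ} (hσ : 1 < σ) :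
    |(deriv χ.LFunction σ / χ.LFunction σ).re| ≤
      1 / (σ - 1) - Real.log Real.pi / 2 + (digamma ((σ : ℂ) / 2 + 1)).re / 2 := by
  have hs : 1 < ((σ : ℂ)).re := by simp [hσ]
  have hnorm : ‖deriv χ.LFunction σ / χ.LFunction σ‖ ≤
      ∑' n : ℕ, ArithmeticFunction.vonMangoldt n / (n : ℝ) ^ σ := by
    rw [← norm_neg, DirichletZFR.neg_logDeriv_LFunction_eq χ hs]
    have := (DirichletZFR.norm_LSeries_twist_le χ hs).2
    simpa only [ofReal_re] using this
  have hzeta : (∑' n : ℕ, ArithmeticFunction.vonMangoldt n / (n : ℝ) ^ σ) =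
      (-(deriv riemannZeta σ / riemannZeta σ)).re := by
    have h := DirichletZFR.LSeries_vonMangoldt_ofReal hσ
    rw [ArithmeticFunction.LSeries_vonMangoldt_eq_deriv_riemannZeta_div hs] at h
    have h' := congrArg Complex.re h
    rw [ofReal_re] at h'
    rw [← h', neg_div]
  have hζ := neg_logDeriv_riemannZeta_re_le hσ
  have hre : |(deriv χ.LFunction σ / χ.LFunction σ).re| ≤ ‖deriv χ.LFunction σ / χ.LFunction σ‖ :=
    Complex.abs_re_le_norm _
  linarith

/-- «`|Re L'/L(1+ε, χ)| ≤ |ζ'/ζ(1+ε)| < 1/ε`» for `0 < ε ≤ 1`. [cite: Tafula2021, Lemma 3.3 (proof,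
arXiv p0006:L44–L47)] -/
theorem abs_re_logDeriv_LFunction_ofReal_lt (χ : DirichletCharacter ℂ q) {σ : ℝ} (hσ1 : 1 < σ)
    (hσ2 : σ ≤ 2) : |(deriv χ.LFunction σ / χ.LFunction σ).re| < 1 / (σ - 1) := by
  have h := abs_re_logDeriv_LFunction_ofReal_le χ hσ1
  have hψ : (digamma ((σ : ℂ) / 2 + 1)).re ≤ 1 - Real.eulerMascheroniConstant := by
    have e : (σ : ℂ) / 2 + 1 = ((σ / 2 + 1 : ℝ) : ℂ) := by push_cast; ring
    rw [e]; exact re_digamma_le_one_sub (by linarith) (by linarith)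
  have hγ := Real.one_half_lt_eulerMascheroniConstant
  have hπ := half_lt_log_pi
  linarith

/-- `Re Γ_ℝ'/Γ_ℝ(x) ≤ 0` for `0 < x ≤ 4` (`ψ(x/2) ≤ ψ(2) = 1 − γ < log π`). [folklore] -/
private theorem re_logDeriv_Gammaℝ_ofReal_nonpos₄ {x : ℝ} (hx : 0 < x) (hx4 : x ≤ 4) :
    (logDeriv Gammaℝ (x : ℂ)).re ≤ 0 := by
  rw [re_logDeriv_Gammaℝ_ofReal' hx]
  have hψ := re_digamma_le_one_sub (x := x / 2) (by linarith) (by linarith)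
  have hγ := Real.one_half_lt_eulerMascheroniConstant
  have hπ := half_lt_log_pi
  linarith

/-- «`0 < ½[ψ((1+ε+a)/2) − ψ((1+a)/2)] < 1`», upper half, in the form: for real `1 ≤ x ≤ y ≤ x + 2`,
`Re Γ_ℝ'/Γ_ℝ(y) − Re Γ_ℝ'/Γ_ℝ(x) ≤ 1` (`ψ(y/2) ≤ ψ(x/2 + 1) = ψ(x/2) + 2/x ≤ ψ(x/2) + 2`).
[cite: Tafula2021, Lemma 3.3 (proof, arXiv p0006:L44)] -/
theorem re_logDeriv_Gammaℝ_ofReal_sub_le_one {x y : ℝ} (hx : 1 ≤ x) (hxy : x ≤ y) (hy : y ≤ x + 2) :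
    (logDeriv Gammaℝ (y : ℂ)).re - (logDeriv Gammaℝ (x : ℂ)).re ≤ 1 := by
  rw [re_logDeriv_Gammaℝ_ofReal' (by linarith : 0 < y), re_logDeriv_Gammaℝ_ofReal' (by linarith : 0 < x)]
  have hmono := KadiriDigamma.re_digamma_ofReal_mono (a := y / 2) (b := x / 2 + 1) (by linarith)
    (by linarith)
  have hne : ∀ m : ℕ, ((x / 2 : ℝ) : ℂ) ≠ -m := fun m h ↦ by
    have := congrArg Complex.re h
    simp at this
    have hm : (0 : ℝ) ≤ m := m.cast_nonneg
    linarith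
  have hstep : (digamma ((x / 2 + 1 : ℝ) : ℂ)).re = (digamma ((x / 2 : ℝ) : ℂ)).re + 2 / x := by
    have h := Complex.digamma_apply_add_one ((x / 2 : ℝ) : ℂ) hne
    rw [show ((x / 2 + 1 : ℝ) : ℂ) = ((x / 2 : ℝ) : ℂ) + 1 by push_cast; ring, h, add_re,
      ← Complex.ofReal_inv, Complex.ofReal_re, inv_div]
  have h2x : 2 / x ≤ 2 := by
    rw [div_le_iff₀ (by linarith)]; linarith
  linarith


/-! ### Part D: the boxed Hadamard indices (`Z(χ) ∩ ℬ̃` in the doubled frame) -/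


/-- The Page box is closed under complex conjugation. [cite: Tafula2021, Proposition 3.2 (arXiv p0006:L9–L11)] -/
theorem conj_mem_pageBox {F : ℝ} {s : ℂ} (hs : s ∈ pageBox F) : conj s ∈ pageBox F := by
  simp only [pageBox, Set.mem_setOf_eq, Complex.conj_re, Complex.conj_im, abs_neg] at hs ⊢
  exact hs

/-- For `F ≥ 2`, `s` and `1 − s` are never both in the Page box (both would have real part `> ½`).
[cite: Tafula2021, Proposition 3.2 (arXiv p0006:L9–L11)] -/
theorem one_sub_not_mem_pageBox {F : ℝ} (hF : 2 ≤ F) {s : ℂ} (hs : s ∈ pageBox F) :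
    1 - s ∉ pageBox F := by
  intro h
  have ha := one_half_lt_re_of_mem_pageBox hF hs
  have hb := one_half_lt_re_of_mem_pageBox hF h
  simp only [sub_re, one_re] at hb
  linarith

/-- A zero of `L(s, χ)` (`χ ≠ 1`) in the Page box (`F ≥ 2`) is a zero of `Ξ_χ` in the open strip.
[cite: Tafula2021, Proposition 3.2 (arXiv p0006:L9–L14)] -/
theorem xiPair_eq_zero_of_zeroOrder_pos (hχ : χ.IsPrimitive) (h1 : χ ≠ 1) {F : ℝ} (hF : 2 ≤ F)
    {z : ℂ} (hz : z ∈ pageBox F) (hm : 0 < DirichletDisc.zeroOrder χ z) : xiPair χ z = 0 := by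
  have hL : χ.LFunction z = 0 := (DirichletDisc.zeroOrder_pos_iff χ h1 z).1 hm
  have h0 : 0 < z.re := by linarith [one_half_lt_re_of_mem_pageBox hF hz]
  have hz1 : z.re < 1 := by
    by_contra h
    exact DirichletCharacter.LFunction_ne_zero_of_one_le_re χ (Or.inl h1) (not_lt.1 h) hL
  have hξ : dirichletXi χ z = 0 :=
    (dirichletXi_eq_zero_iff_mem_charNontrivialZeros hχ h1 z).2 ⟨hL, h0, hz1⟩
  show dirichletXi χ z * dirichletXi χ⁻¹ z = 0
  rw [hξ, zero_mul]

/-- **The boxed indices (the `Z(χ) ∩ ℬ̃` bookkeeping of the printed proof, doubled).** For a Hadamard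
sequence `b` of `Ξ_χ`, the Page box `ℬ = ℬ_f` (`F ≥ 2`) and the finite set `𝒮 = Z(χ) ∩ ℬ` of zeros of
`L(s, χ)` in `ℬ` (with multiplicities `m = m_χ`): the live indices `k` whose pair `{ρ_k, 1 − ρ_k}` meets
`ℬ` split as `I₀` (`ρ_k ∈ ℬ`) and `I₁` (`1 − ρ_k ∈ ℬ`), all other live pairs avoid `ℬ ∪ (1 − ℬ)`,
`|I₀| + |I₁| = 2 Σ_{ρ∈𝒮} m(ρ)` and the boxed halves add up to `2 Σ_{ρ∈𝒮} m(ρ) Re(1/(1−ρ))` (the fibre of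
the half-terms over a zero `z` of `Ξ_χ` has `m_χ(z) + m_χ̄(z) = m_χ(z) + m_χ(z̄)` elements,
`ncard_index_add_ncard_index_eq`). [cite: Tafula2021, §3.2, proof of Proposition 3.2 (arXiv p0007:L76–L95)] -/
theorem exists_boxed_index_finsets (hχ : χ.IsPrimitive) (h1 : χ ≠ 1) (hbs : Summable fun n ↦ ‖b n‖)
    (h2 : xiPair χ 2 ≠ 0)
    (hmult : ∀ a : ℂ, a ≠ 0 →
      {n : ℕ | b n = a⁻¹}.ncard = analyticOrderNatAt (fun w ↦ xiPairLift χ (w + 9 / 4)) a)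
    (hprod : ∀ z : ℂ, HasProd (fun n ↦ 1 - b n * (z ^ 2 - 9 / 4)) (xiPair χ (1 / 2 + z) / xiPair χ 2))
    {F : ℝ} (hF : 2 ≤ F) (S : Finset ℂ)
    (hS : ∀ ρ : ℂ, ρ ∈ S ↔ ρ ∈ pageBox F ∧ 0 < DirichletDisc.zeroOrder χ ρ) :
    ∃ I₀ I₁ : Finset ℕ, Disjoint I₀ I₁ ∧
      (∀ k ∈ I₀, b k ≠ 0 ∧ xiPairZero b k ∈ pageBox F) ∧
      (∀ k ∈ I₁, b k ≠ 0 ∧ 1 - xiPairZero b k ∈ pageBox F) ∧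
      (∀ k, b k ≠ 0 → k ∉ I₀ ∪ I₁ → xiPairZero b k ∉ pageBox F ∧ 1 - xiPairZero b k ∉ pageBox F) ∧
      ((I₀.card : ℝ) + I₁.card = 2 * ∑ ρ ∈ S, (DirichletDisc.zeroOrder χ ρ : ℝ)) ∧
      (∑ k ∈ I₀, (1 / (1 - xiPairZero b k)).re + ∑ k ∈ I₁, (1 / (1 - (1 - xiPairZero b k))).re =
        2 * ∑ ρ ∈ S, (DirichletDisc.zeroOrder χ ρ : ℝ) * (1 / (1 - ρ)).re) := by
  classical
  set S' : Finset ℂ := S ∪ S.image conj with hS'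
  set m : ℂ → ℕ := fun z ↦ DirichletDisc.zeroOrder χ z with hm
  set f : ℂ → ℝ := fun z ↦ (1 / (1 - z)).re with hf
  have hSsub : S ⊆ S' := Finset.subset_union_left
  have hS'mem : ∀ z ∈ S', z ∈ S ∨ conj z ∈ S := by
    intro z hz
    rcases Finset.mem_union.1 hz with h | h
    · exact Or.inl h
    · obtain ⟨u, hu, rfl⟩ := Finset.mem_image.1 h
      exact Or.inr (by simpa using hu)
  have hS'box : ∀ z ∈ S', z ∈ pageBox F := by
    intro z hz
    rcases hS'mem z hz with h | h
    · exact ((hS z).1 h).1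
    · have := conj_mem_pageBox ((hS _).1 h).1
      rwa [Complex.conj_conj] at this
  have hSzero : ∀ z ∈ S, xiPair χ z = 0 := fun z hz ↦
    xiPair_eq_zero_of_zeroOrder_pos hχ h1 hF ((hS z).1 hz).1 ((hS z).1 hz).2
  have hS'zero : ∀ z ∈ S', xiPair χ z = 0 := by
    intro z hz
    rcases hS'mem z hz with h | h
    · exact hSzero z h
    · have := congrArg conj (hSzero (conj z) h)
      rwa [conj_xiPair h1, Complex.conj_conj, map_zero] at this
  -- in the box, `z ∈ S ↔ m z > 0`; outside `S` (but in `S'`), `m z = 0`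
  have hm0 : ∀ z ∈ S', z ∉ S → m z = 0 := by
    intro z hz hzS
    by_contra h
    exact hzS ((hS z).2 ⟨hS'box z hz, Nat.pos_of_ne_zero h⟩)
  -- the fibres
  have hfinA : ∀ z : ℂ, {k : ℕ | b k ≠ 0 ∧ xiPairZero b k = z}.Finite := fun z ↦
    (finite_index hbs z).subset fun k hk ↦ ⟨hk.1, Or.inl hk.2⟩
  have hfinB : ∀ z : ℂ, {k : ℕ | b k ≠ 0 ∧ 1 - xiPairZero b k = z}.Finite := fun z ↦
    (finite_index hbs z).subset fun k hk ↦ ⟨hk.1, Or.inr hk.2⟩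
  have hcardAB : ∀ z ∈ S', ((hfinA z).toFinset.card : ℝ) + (hfinB z).toFinset.card = m z + m (conj z) := by
    intro z hz
    have h := ncard_index_add_ncard_index_eq hχ h1 hmult (hS'zero z hz)
    rw [Set.ncard_eq_toFinset_card _ (hfinA z), Set.ncard_eq_toFinset_card _ (hfinB z)] at h
    have hconj : DirichletDisc.zeroOrder χ⁻¹ z = m (conj z) := by
      show DirichletDisc.zeroOrder χ⁻¹ z = DirichletDisc.zeroOrder χ (conj z)
      rw [← zeroOrder_inv_conj' h1 (conj z), Complex.conj_conj]
    rw [hconj] at h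
    exact_mod_cast h
  -- the index sets
  refine ⟨S'.biUnion fun z ↦ (hfinA z).toFinset, S'.biUnion fun z ↦ (hfinB z).toFinset, ?_, ?_, ?_, ?_, ?_, ?_⟩
  · -- disjointness
    rw [Finset.disjoint_left]
    intro k hk0 hk1
    obtain ⟨z, hz, hkz⟩ := Finset.mem_biUnion.1 hk0
    obtain ⟨z', hz', hkz'⟩ := Finset.mem_biUnion.1 hk1
    rw [Set.Finite.mem_toFinset, Set.mem_setOf_eq] at hkz hkz'
    have hb0 : xiPairZero b k ∈ pageBox F := hkz.2 ▸ hS'box z hz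
    have hb1 : 1 - xiPairZero b k ∈ pageBox F := hkz'.2 ▸ hS'box z' hz'
    exact one_sub_not_mem_pageBox hF hb0 hb1
  · intro k hk
    obtain ⟨z, hz, hkz⟩ := Finset.mem_biUnion.1 hk
    rw [Set.Finite.mem_toFinset, Set.mem_setOf_eq] at hkz
    exact ⟨hkz.1, hkz.2 ▸ hS'box z hz⟩
  · intro k hk
    obtain ⟨z, hz, hkz⟩ := Finset.mem_biUnion.1 hk
    rw [Set.Finite.mem_toFinset, Set.mem_setOf_eq] at hkz
    exact ⟨hkz.1, hkz.2 ▸ hS'box z hz⟩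
  · -- the complement avoids `ℬ ∪ (1 − ℬ)`
    intro k hbk hk
    rw [Finset.mem_union, not_or] at hk
    -- a live half-term in the box lies over a point of `S'`
    have key : ∀ z : ℂ, xiPair χ z = 0 → z ∈ pageBox F →
        (xiPairZero b k = z ∨ 1 - xiPairZero b k = z) → z ∈ S' := by
      intro z hΞ hzbox hkz
      have h := ncard_index_add_ncard_index_eq hχ h1 hmult hΞ
      have hpos : 0 < {k : ℕ | b k ≠ 0 ∧ xiPairZero b k = z}.ncard +
          {k : ℕ | b k ≠ 0 ∧ 1 - xiPairZero b k = z}.ncard := by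
        rcases hkz with hkz | hkz
        · have : 0 < {k : ℕ | b k ≠ 0 ∧ xiPairZero b k = z}.ncard :=
            (Set.ncard_pos (hfinA z)).2 ⟨k, hbk, hkz⟩
          omega
        · have : 0 < {k : ℕ | b k ≠ 0 ∧ 1 - xiPairZero b k = z}.ncard :=
            (Set.ncard_pos (hfinB z)).2 ⟨k, hbk, hkz⟩
          omega
      rw [h] at hpos
      rcases Nat.add_pos_iff_pos_or_pos.1 hpos with hmz | hmz
      · exact hSsub ((hS z).2 ⟨hzbox, hmz⟩)
      · have hmz' : 0 < DirichletDisc.zeroOrder χ (conj z) := by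
          rw [← zeroOrder_inv_conj' h1 (conj z), Complex.conj_conj]; exact hmz
        have hcS : conj z ∈ S := (hS _).2 ⟨conj_mem_pageBox hzbox, hmz'⟩
        exact Finset.mem_union.2 (Or.inr (Finset.mem_image.2 ⟨conj z, hcS, Complex.conj_conj z⟩))
    constructor
    · intro hbox
      have hz : xiPairZero b k ∈ S' :=
        key _ (xiPair_xiPairZero h2 hprod hbk) hbox (Or.inl rfl)
      exact hk.1 (Finset.mem_biUnion.2 ⟨_, hz, by rw [Set.Finite.mem_toFinset]; exact ⟨hbk, rfl⟩⟩)
    · intro hbox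
      have hΞ : xiPair χ (1 - xiPairZero b k) = 0 := by
        rw [xiPair_one_sub hχ]; exact xiPair_xiPairZero h2 hprod hbk
      have hz : 1 - xiPairZero b k ∈ S' := key _ hΞ hbox (Or.inr rfl)
      exact hk.2 (Finset.mem_biUnion.2 ⟨_, hz, by rw [Set.Finite.mem_toFinset]; exact ⟨hbk, rfl⟩⟩)
  · -- cardinality
    have hdisjA : (S' : Set ℂ).PairwiseDisjoint fun z ↦ (hfinA z).toFinset := by
      intro z _ z' _ hne
      rw [Function.onFun, Finset.disjoint_left]
      intro k hk hk'
      rw [Set.Finite.mem_toFinset, Set.mem_setOf_eq] at hk hk'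
      exact hne (hk.2.symm.trans hk'.2)
    have hdisjB : (S' : Set ℂ).PairwiseDisjoint fun z ↦ (hfinB z).toFinset := by
      intro z _ z' _ hne
      rw [Function.onFun, Finset.disjoint_left]
      intro k hk hk'
      rw [Set.Finite.mem_toFinset, Set.mem_setOf_eq] at hk hk'
      exact hne (hk.2.symm.trans hk'.2)
    rw [Finset.card_biUnion hdisjA, Finset.card_biUnion hdisjB]
    push_cast
    rw [← Finset.sum_add_distrib, Finset.sum_congr rfl hcardAB, Finset.sum_add_distrib]
    -- `Σ_{S'} m(conj z) = Σ_{S'} m z` and `Σ_{S'} m = Σ_S m`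
    have hS'im : S'.image conj = S' := by
      rw [hS', Finset.image_union, Finset.image_image]
      have hcc : ((starRingEnd ℂ : ℂ → ℂ) ∘ (starRingEnd ℂ : ℂ → ℂ)) = id := by
        funext z; exact Complex.conj_conj z
      rw [hcc, Finset.image_id, Finset.union_comm]
    have hsum_conj : ∀ g : ℂ → ℝ, ∑ z ∈ S', g (conj z) = ∑ z ∈ S', g z := by
      intro g
      have hinj : ∀ x ∈ S', ∀ y ∈ S', conj x = conj y → x = y :=
        fun x _ y _ h ↦ by simpa using congrArg conj h
      rw [← Finset.sum_image hinj, hS'im]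
    have hsumS : ∑ z ∈ S', (m z : ℝ) = ∑ z ∈ S, (m z : ℝ) := by
      rw [← Finset.sum_subset hSsub fun z hz hzS ↦ by rw [hm0 z hz hzS]; simp]
    rw [hsum_conj (fun z ↦ (m z : ℝ)), hsumS]
    ring
  · -- the values of the boxed halves
    have hdisjA : (S' : Set ℂ).PairwiseDisjoint fun z ↦ (hfinA z).toFinset := by
      intro z _ z' _ hne
      rw [Function.onFun, Finset.disjoint_left]
      intro k hk hk'
      rw [Set.Finite.mem_toFinset, Set.mem_setOf_eq] at hk hk'
      exact hne (hk.2.symm.trans hk'.2)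
    have hdisjB : (S' : Set ℂ).PairwiseDisjoint fun z ↦ (hfinB z).toFinset := by
      intro z _ z' _ hne
      rw [Function.onFun, Finset.disjoint_left]
      intro k hk hk'
      rw [Set.Finite.mem_toFinset, Set.mem_setOf_eq] at hk hk'
      exact hne (hk.2.symm.trans hk'.2)
    rw [Finset.sum_biUnion hdisjA, Finset.sum_biUnion hdisjB]
    have eA : ∀ z ∈ S', ∑ k ∈ (hfinA z).toFinset, (1 / (1 - xiPairZero b k)).re =
        ((hfinA z).toFinset.card : ℝ) * f z := by
      intro z _
      have e : ∑ k ∈ (hfinA z).toFinset, (1 / (1 - xiPairZero b k)).re =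
          ∑ k ∈ (hfinA z).toFinset, f z :=
        Finset.sum_congr rfl fun k hk ↦ by
          have hk' := (Set.Finite.mem_toFinset (hfinA z)).1 hk
          exact congrArg (fun w : ℂ ↦ (1 / (1 - w)).re) hk'.2
      rw [e, Finset.sum_const, nsmul_eq_mul]
    have eB : ∀ z ∈ S', ∑ k ∈ (hfinB z).toFinset, (1 / (1 - (1 - xiPairZero b k))).re =
        ((hfinB z).toFinset.card : ℝ) * f z := by
      intro z _
      have e : ∑ k ∈ (hfinB z).toFinset, (1 / (1 - (1 - xiPairZero b k))).re =
          ∑ k ∈ (hfinB z).toFinset, f z :=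
        Finset.sum_congr rfl fun k hk ↦ by
          have hk' := (Set.Finite.mem_toFinset (hfinB z)).1 hk
          exact congrArg (fun w : ℂ ↦ (1 / (1 - w)).re) hk'.2
      rw [e, Finset.sum_const, nsmul_eq_mul]
    rw [Finset.sum_congr rfl eA, Finset.sum_congr rfl eB, ← Finset.sum_add_distrib]
    have e2 : ∀ z ∈ S', ((hfinA z).toFinset.card : ℝ) * f z + ((hfinB z).toFinset.card : ℝ) * f z =
        (m z : ℝ) * f z + (m (conj z) : ℝ) * f (conj z) := by
      intro z hz
      have hfc : f (conj z) = f z := re_one_div_one_sub_conj z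
      rw [← add_mul, hcardAB z hz, hfc]; ring
    rw [Finset.sum_congr rfl e2, Finset.sum_add_distrib]
    have hS'im : S'.image conj = S' := by
      rw [hS', Finset.image_union, Finset.image_image]
      have hcc : ((starRingEnd ℂ : ℂ → ℂ) ∘ (starRingEnd ℂ : ℂ → ℂ)) = id := by
        funext z; exact Complex.conj_conj z
      rw [hcc, Finset.image_id, Finset.union_comm]
    have hsum_conj : ∀ g : ℂ → ℝ, ∑ z ∈ S', g (conj z) = ∑ z ∈ S', g z := by
      intro g
      have hinj : ∀ x ∈ S', ∀ y ∈ S', conj x = conj y → x = y :=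
        fun x _ y _ h ↦ by simpa using congrArg conj h
      rw [← Finset.sum_image hinj, hS'im]
    have hsumS : ∑ z ∈ S', (m z : ℝ) * f z = ∑ z ∈ S, (m z : ℝ) * f z := by
      rw [← Finset.sum_subset hSsub fun z hz hzS ↦ by rw [hm0 z hz hzS]; simp]
    rw [hsum_conj (fun z ↦ (m z : ℝ) * f z), hsumS]
    ring


/-! ### Part E: assembly of Proposition 3.2 -/


/-- Outside `ℬ ∪ (1 − ℬ)` (`ℬ = ℬ_f`, `F ≥ 2`), a point of the open strip lies in `R₁ ∪ R₂ ∪ R₃`: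
`t² ≥ 1`, or `2Fσ(1−σ) ≥ 1` (from `1/F ≤ σ ≤ 1 − 1/F`), or `2Ft² ≥ 1 + t²` (from `1/F ≤ t² < 1`).
[cite: Tafula2021, Lemma 3.4 (ii) and its partition of the strip (arXiv p0006:L45–L49)] -/
theorem regime_of_not_mem_pageBox {F : ℝ} (hF : 2 ≤ F) {s : ℂ}
    (hs : s ∉ pageBox F) (hs' : 1 - s ∉ pageBox F) :
    1 ≤ s.im ^ 2 ∨ (1 ≤ 2 * F * (s.re * (1 - s.re)) ∨ 1 + s.im ^ 2 ≤ 2 * F * s.im ^ 2) := by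
  have hF0 : 0 < F := by linarith
  by_cases ht : 1 / Real.sqrt F ≤ |s.im|
  · have hsq : 1 / F ≤ s.im ^ 2 := by
      have h := pow_le_pow_left₀ (by positivity) ht 2
      rw [div_pow, one_pow, Real.sq_sqrt hF0.le, sq_abs] at h
      exact h
    by_cases h1t : 1 ≤ s.im ^ 2
    · exact Or.inl h1t
    · right; right
      have h1F : 1 ≤ F * s.im ^ 2 := by
        rw [div_le_iff₀ hF0] at hsq; linarith
      linarith [lt_of_not_ge h1t]
  · have ht' : |s.im| < 1 / Real.sqrt F := lt_of_not_ge ht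
    have hσ1 : s.re ≤ 1 - 1 / F := by
      by_contra h
      exact hs ⟨lt_of_not_ge h, ht'⟩
    have hσ0 : 1 / F ≤ s.re := by
      by_contra h
      refine hs' ⟨?_, ?_⟩
      · simp only [sub_re, one_re]; linarith [lt_of_not_ge h]
      · simpa only [sub_im, one_im, zero_sub, abs_neg] using ht'
    right; left
    have hprod : 1 / F * (1 - 1 / F) ≤ s.re * (1 - s.re) := by nlinarith
    have h12 : 1 / F ≤ 1 / 2 := by
      rw [div_le_div_iff₀ hF0 two_pos]; linarith
    have e : 2 * F * (1 / F * (1 - 1 / F)) = 2 * (1 - 1 / F) := by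
      field_simp
    have := mul_le_mul_of_nonneg_left hprod (by positivity : (0 : ℝ) ≤ 2 * F)
    rw [e] at this
    linarith

/-- **The engine of Proposition 3.2, for every `M ≥ 2` (no cap `M ≤ 4 log q`)** — the penultimate
display of the printed proof: for a primitive `χ` mod `q ≥ 2`, `M ≥ 2` and `𝒮 = Z(χ) ∩ ℬ_{1/M}` with
multiplicities, `|Re L'/L(1,χ) − Σ_{ρ∈𝒮} m(ρ) Re(1/(1−ρ))| < (7/2 + 2n)√(M log q) + 5M + 1`,
`n = Σ_𝒮 m` («we conclude that it is `< (7/2 + 2|Z(χ)∩ℬ|)√(M log q) + 5M + 1`»). PROVED (doubled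
frame; see the section docstring): boxed indices `I = I₀ ∪ I₁` (`exists_boxed_index_finsets`),
Lemma 3.4 (ii) off the box (`abs_pairing_zero_sub_le`, `regime_of_not_mem_pageBox`), `Π_ε/2 ≤ 2/ε` on
the box, Lemma 3.3 two-sided at `1 + ε`, `ε = (M log q)^{-1/2}`. This is the form consumed by the
Táfula 2025 theorems (admissible `f ≤ C log q`, any `C`).
[cite: Tafula2021, Proposition 3.2, proof, penultimate display (arXiv p0007:L95–L103)] -/
theorem abs_re_logDeriv_sub_pageBox_lt {q : ℕ} [NeZero q] (hq : 2 ≤ q) (χ : DirichletCharacter ℂ q)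
    (hχ : χ.IsPrimitive) {F : ℝ} (hF2 : 2 ≤ F) (S : Finset ℂ)
    (hS : ∀ ρ : ℂ, ρ ∈ S ↔ ρ ∈ pageBox F ∧ 0 < DirichletDisc.zeroOrder χ ρ) :
    |(deriv χ.LFunction 1 / χ.LFunction 1 -
        ∑ ρ ∈ S, (DirichletDisc.zeroOrder χ ρ : ℂ) * (1 / (1 - ρ))).re| <
      (7 / 2 + 2 * ∑ ρ ∈ S, (DirichletDisc.zeroOrder χ ρ : ℝ)) * Real.sqrt (F * Real.log q) +
        5 * F + 1 := by
  classical
  have h1 : χ ≠ 1 := ne_one_of_isPrimitive'' hq hχ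
  obtain ⟨b, hbs, -, hmult, hprod⟩ := exists_xiPair_hadamardSeq hχ h1
  have h2 : xiPair χ 2 ≠ 0 := xiPair_two_ne_zero hχ h1
  -- the constants: `log q ≥ log 2 > 0.69`, `r = √(F log q) > 1`, `ε = 1/r`
  have hq2 : (2 : ℝ) ≤ q := by exact_mod_cast hq
  have hLq : Real.log 2 ≤ Real.log q := Real.log_le_log two_pos hq2
  have hlog2 := Real.log_two_gt_d9
  have hF0 : 0 < F := by linarith
  obtain ⟨r, hr⟩ : ∃ r : ℝ, r = Real.sqrt (F * Real.log q) := ⟨_, rfl⟩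
  have hrsq : r ^ 2 = F * Real.log q := by rw [hr]; exact Real.sq_sqrt (by nlinarith)
  have hr1 : 1 < r := by
    rw [hr, show (1 : ℝ) = Real.sqrt 1 by simp]
    exact Real.sqrt_lt_sqrt zero_le_one (by nlinarith)
  have hrpos : 0 < r := by linarith
  obtain ⟨ε, hε⟩ : ∃ ε : ℝ, ε = 1 / r := ⟨_, rfl⟩
  have hε0 : 0 < ε := by rw [hε]; positivity
  have hεr : ε * r = 1 := by rw [hε]; field_simp
  have hε1 : ε < 1 := by
    rw [hε, div_lt_one hrpos]; exact hr1
  have hinvε : 1 / ε = r := by rw [hε, one_div_one_div]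
  have hFεL : F * ε * Real.log q = r := by
    have : F * ε * Real.log q = r ^ 2 * ε := by rw [hrsq]; ring
    rw [this, pow_two, mul_assoc, mul_comm r ε, hεr, mul_one]
  have hFεr : F * ε * r = F := by rw [mul_assoc, hεr, mul_one]
  have hFε0 : 0 ≤ F * ε := by positivity
  obtain ⟨φ, hφ⟩ : ∃ φ : ℝ, φ = 1 + ε := ⟨_, rfl⟩
  have hφ1 : 1 < φ := by rw [hφ]; linarith
  have hφ2 : φ ≤ 2 := by rw [hφ]; linarith
  -- `Ξ_χ ≠ 0` at the real points `σ ≥ 1`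
  have hΞne : ∀ σ : ℝ, 1 ≤ σ → xiPair χ (σ : ℂ) ≠ 0 := by
    intro σ hσ h
    have := (re_mem_Ioo_of_xiPair_eq_zero hχ h1 h).2
    simp only [ofReal_re] at this
    linarith
  -- the terms of the partial-fraction series of `Ξ_χ'/Ξ_χ` at a real point `σ`
  obtain ⟨T, hT⟩ : ∃ T : ℝ → ℕ → ℂ, T = fun (σ : ℝ) (n : ℕ) ↦
      -(2 * b n * ((σ : ℂ) - 1 / 2)) / (1 - b n * (((σ : ℂ) - 1 / 2) ^ 2 - 9 / 4)) := ⟨_, rfl⟩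
  have hTs : ∀ σ : ℝ, Summable (T σ) := fun σ ↦ by
    rw [hT]; exact summable_logDeriv_factor hbs (9 / 4) ((σ : ℂ) - 1 / 2)
  have hTre : ∀ σ : ℝ, Summable fun n ↦ (T σ n).re := fun σ ↦
    (Complex.hasSum_re (hTs σ).hasSum).summable
  -- **(3.2) doubled**
  have hU : ∀ σ : ℝ, 1 ≤ σ → ∑' n, (T σ n).re = Real.log q +
      2 * (logDeriv Gammaℝ ((σ : ℂ) + charParity χ)).re +
        2 * (deriv χ.LFunction σ / χ.LFunction σ).re := by
    intro σ hσ
    rw [← re_logDeriv_xiPair_ofReal hχ h1 hσ, logDeriv_xiPair_eq_tsum hbs h2 h1 hprod (hΞne σ hσ),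
      Complex.re_tsum (summable_logDeriv_factor hbs (9 / 4) ((σ : ℂ) - 1 / 2)), hT]
  -- the zeros `ρ_k` and the real parts of the terms at `σ = 1` and `σ = φ = 1 + ε`
  have hρ : ∀ k, b k ≠ 0 → 0 < (xiPairZero b k).re ∧ (xiPairZero b k).re < 1 :=
    fun k hk ↦ re_mem_Ioo_of_xiPair_eq_zero hχ h1 (xiPair_xiPairZero h2 hprod hk)
  have hT1 : ∀ k, b k ≠ 0 → (T 1 k).re = pairing 0 (xiPairZero b k) / 2 := by
    intro k hk
    have h := re_term_eq_pairing_div_two h2 hprod (ε := 0) (by rw [add_zero]; exact hΞne 1 le_rfl) hk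
    rw [add_zero] at h
    rw [hT]; exact h
  have hTφ : ∀ k, b k ≠ 0 → (T φ k).re = pairing ε (xiPairZero b k) / 2 := by
    intro k hk
    have h := re_term_eq_pairing_div_two h2 hprod (ε := ε) (by rw [← hφ]; exact hΞne φ hφ1.le) hk
    rw [← hφ] at h
    rw [hT]; exact h
  have hT0 : ∀ (σ : ℝ) (k : ℕ), b k = 0 → (T σ k).re = 0 := fun σ k hk ↦ by rw [hT]; simp [hk]
  have hnn : ∀ (σ : ℝ), 1 ≤ σ → ∀ k, 0 ≤ (T σ k).re := by
    intro σ hσ k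
    by_cases hk : b k = 0
    · rw [hT0 σ k hk]
    · have e : (1 + (σ - 1) : ℝ) = σ := by ring
      have h := re_term_eq_pairing_div_two h2 hprod (ε := σ - 1) (by rw [e]; exact hΞne σ hσ) hk
      rw [e] at h
      rw [hT, h]
      exact div_nonneg (pairing_nonneg (by linarith) (hρ k hk).1 (hρ k hk).2) zero_le_two
  have hbdφ : ∀ k, (T φ k).re ≤ 2 * r := by
    intro k
    by_cases hk : b k = 0
    · rw [hT0 φ k hk]; linarith
    · rw [hTφ k hk, ← hinvε]
      have h := pairing_div_two_le hε0 (hρ k hk).1 (hρ k hk).2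
      have : 2 / ε = 2 * (1 / ε) := by ring
      linarith
  -- **the boxed indices**
  obtain ⟨I₀, I₁, hdisj, hI₀, hI₁, hcomp, hcard, hval⟩ :=
    exists_boxed_index_finsets hχ h1 hbs h2 hmult hprod hF2 S hS
  -- Lemma 3.4 (ii) off the box
  have hcmpU : ∀ k, k ∉ I₀ ∪ I₁ → (T 1 k).re ≤ (1 + 5 * F * ε) * (T φ k).re := by
    intro k hk
    by_cases hbk : b k = 0
    · rw [hT0 1 k hbk, hT0 φ k hbk, mul_zero]
    · obtain ⟨hb0, hb1⟩ := hcomp k hbk hk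
      have hreg := regime_of_not_mem_pageBox hF2 hb0 hb1
      have h := pairing_zero_le_mul hF2 hε0 hε1 (hρ k hbk).1 (hρ k hbk).2 hreg
      rw [hT1 k hbk, hTφ k hbk]
      linarith
  have hcmpL : ∀ k, k ∉ I₀ ∪ I₁ → (1 - 5 * F * ε) * (T φ k).re ≤ (T 1 k).re := by
    intro k hk
    by_cases hbk : b k = 0
    · rw [hT0 1 k hbk, hT0 φ k hbk, mul_zero]
    · obtain ⟨hb0, hb1⟩ := hcomp k hbk hk
      have hreg := regime_of_not_mem_pageBox hF2 hb0 hb1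
      have h := mul_pairing_le_pairing_zero hF2 hε0 (hρ k hbk).1 (hρ k hbk).2 hreg
      rw [hT1 k hbk, hTφ k hbk]
      linarith
  -- the terms on the box at `σ = 1`: boxed half + free half, the free half in `[0, 2]`
  have hA0 : ∑ k ∈ I₀, (T 1 k).re =
      ∑ k ∈ I₀, (1 / (1 - xiPairZero b k)).re + ∑ k ∈ I₀, (1 / xiPairZero b k).re := by
    rw [← Finset.sum_add_distrib]
    exact Finset.sum_congr rfl fun k hk ↦ by rw [hT1 k (hI₀ k hk).1, pairing_zero_div_two]
  have hA1 : ∑ k ∈ I₁, (T 1 k).re =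
      ∑ k ∈ I₁, (1 / (1 - xiPairZero b k)).re + ∑ k ∈ I₁, (1 / xiPairZero b k).re := by
    rw [← Finset.sum_add_distrib]
    exact Finset.sum_congr rfl fun k hk ↦ by rw [hT1 k (hI₁ k hk).1, pairing_zero_div_two]
  have hval' : ∑ k ∈ I₀, (1 / (1 - xiPairZero b k)).re + ∑ k ∈ I₁, (1 / xiPairZero b k).re =
      2 * ∑ ρ ∈ S, (DirichletDisc.zeroOrder χ ρ : ℝ) * (1 / (1 - ρ)).re := by
    rw [← hval]
    simp only [sub_sub_cancel]
  have hO0 : 0 ≤ ∑ k ∈ I₀, (1 / xiPairZero b k).re ∧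
      ∑ k ∈ I₀, (1 / xiPairZero b k).re ≤ 2 * I₀.card := by
    have hb : ∀ k ∈ I₀, 0 ≤ (1 / xiPairZero b k).re ∧ (1 / xiPairZero b k).re ≤ 2 := by
      intro k hk
      have hσ := one_half_lt_re_of_mem_pageBox hF2 (hI₀ k hk).2
      rw [one_div, re_inv_eq']
      refine ⟨div_nonneg (by linarith) (by positivity), ?_⟩
      have h := div_sq_add_le (by linarith : 0 < (xiPairZero b k).re) (sq_nonneg (xiPairZero b k).im)
      have h2 : 1 / (xiPairZero b k).re ≤ 2 := by
        rw [div_le_iff₀ (by linarith)]; linarith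
      linarith
    refine ⟨Finset.sum_nonneg fun k hk ↦ (hb k hk).1, ?_⟩
    have h := Finset.sum_le_sum fun k hk ↦ (hb k hk).2
    rw [Finset.sum_const, nsmul_eq_mul] at h
    linarith
  have hO1 : 0 ≤ ∑ k ∈ I₁, (1 / (1 - xiPairZero b k)).re ∧
      ∑ k ∈ I₁, (1 / (1 - xiPairZero b k)).re ≤ 2 * I₁.card := by
    have hb : ∀ k ∈ I₁, 0 ≤ (1 / (1 - xiPairZero b k)).re ∧ (1 / (1 - xiPairZero b k)).re ≤ 2 := by
      intro k hk
      have hσ := one_half_lt_re_of_mem_pageBox hF2 (hI₁ k hk).2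
      rw [one_div, re_inv_eq']
      refine ⟨div_nonneg (by linarith) (by positivity), ?_⟩
      have h := div_sq_add_le (by linarith : 0 < (1 - xiPairZero b k).re)
        (sq_nonneg (1 - xiPairZero b k).im)
      have h2 : 1 / (1 - xiPairZero b k).re ≤ 2 := by
        rw [div_le_iff₀ (by linarith)]; linarith
      linarith
    refine ⟨Finset.sum_nonneg fun k hk ↦ (hb k hk).1, ?_⟩
    have h := Finset.sum_le_sum fun k hk ↦ (hb k hk).2
    rw [Finset.sum_const, nsmul_eq_mul] at h
    linarith
  -- the terms on the box at `σ = φ`: in `[0, 2/ε] = [0, 2r]`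
  have hAφ : ∑ k ∈ I₀ ∪ I₁, (T φ k).re ≤ ((I₀ ∪ I₁).card : ℝ) * (2 * r) := by
    have h := Finset.sum_le_sum fun k (_ : k ∈ I₀ ∪ I₁) ↦ hbdφ k
    rwa [Finset.sum_const, nsmul_eq_mul] at h
  have hAφ0 : 0 ≤ ∑ k ∈ I₀ ∪ I₁, (T φ k).re := Finset.sum_nonneg fun k _ ↦ hnn φ hφ1.le k
  have hIcard : ((I₀ ∪ I₁).card : ℝ) = 2 * ∑ ρ ∈ S, (DirichletDisc.zeroOrder χ ρ : ℝ) := by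
    rw [Finset.card_union_of_disjoint hdisj]; push_cast; exact hcard
  have hn0 : 0 ≤ ∑ ρ ∈ S, (DirichletDisc.zeroOrder χ ρ : ℝ) :=
    Finset.sum_nonneg fun ρ _ ↦ Nat.cast_nonneg _
  rw [hIcard] at hAφ
  have hsum1 : ∑ k ∈ I₀ ∪ I₁, (T 1 k).re = ∑ k ∈ I₀, (T 1 k).re + ∑ k ∈ I₁, (T 1 k).re :=
    Finset.sum_union hdisj
  -- splitting `U(1)` and `U(φ)` along `I = I₀ ∪ I₁`
  have hsplit1 := (hTre 1).sum_add_tsum_subtype_compl (I₀ ∪ I₁)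
  have hsplitφ := (hTre φ).sum_add_tsum_subtype_compl (I₀ ∪ I₁)
  beta_reduce at hsplit1 hsplitφ
  have hc1 : Summable fun k : {k // k ∉ I₀ ∪ I₁} ↦ (T 1 k).re :=
    (hTre 1).comp_injective Subtype.val_injective
  have hcφ : Summable fun k : {k // k ∉ I₀ ∪ I₁} ↦ (T φ k).re :=
    (hTre φ).comp_injective Subtype.val_injective
  have hRU : ∑' k : {k // k ∉ I₀ ∪ I₁}, (T 1 k).re ≤
      (1 + 5 * F * ε) * ∑' k : {k // k ∉ I₀ ∪ I₁}, (T φ k).re := by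
    rw [← tsum_mul_left]
    exact Summable.tsum_le_tsum (fun k ↦ hcmpU k.1 k.2) hc1 (hcφ.mul_left _)
  have hRL : (1 - 5 * F * ε) * ∑' k : {k // k ∉ I₀ ∪ I₁}, (T φ k).re ≤
      ∑' k : {k // k ∉ I₀ ∪ I₁}, (T 1 k).re := by
    rw [← tsum_mul_left]
    exact Summable.tsum_le_tsum (fun k ↦ hcmpL k.1 k.2) (hcφ.mul_left _) hc1
  have hRφ0 : 0 ≤ ∑' k : {k // k ∉ I₀ ∪ I₁}, (T φ k).re := tsum_nonneg fun k ↦ hnn φ hφ1.le k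
  -- the explicit formulas at `1` and `φ`
  have hU1 := hU 1 le_rfl
  have hUφ := hU φ hφ1.le
  rw [Complex.ofReal_one] at hU1
  -- the product facts `5Fε · (rest at φ) ≤ 5Fε · U(φ)` and `Fε · U(φ)` expanded
  have hRφU : ∑' k : {k // k ∉ I₀ ∪ I₁}, (T φ k).re ≤ ∑' n, (T φ n).re := by linarith
  have h5R := mul_le_mul_of_nonneg_left hRφU (by positivity : (0 : ℝ) ≤ 5 * F * ε)
  have h5U : 5 * F * ε * ∑' n, (T φ n).re = 5 * (F * ε * Real.log q) +
      10 * (F * ε * (logDeriv Gammaℝ ((φ : ℂ) + charParity χ)).re) +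
        10 * (F * ε * (deriv χ.LFunction φ / χ.LFunction φ).re) := by
    rw [hUφ]; ring
  -- the `Γ_ℝ` terms: `0 ≤ g(φ+κ) − g(1+κ) ≤ 1`, `g(φ+κ) ≤ 0`
  have hκ1 : (charParity χ : ℝ) ≤ 1 := by
    have : charParity χ ≤ 1 := by unfold charParity; split_ifs <;> norm_num
    exact_mod_cast this
  have hκ0 : (0 : ℝ) ≤ charParity χ := Nat.cast_nonneg _
  have eκ1 : (1 : ℂ) + (charParity χ : ℂ) = ((1 + charParity χ : ℝ) : ℂ) := by push_cast; ring
  have eκφ : (φ : ℂ) + (charParity χ : ℂ) = ((φ + charParity χ : ℝ) : ℂ) := by push_cast; ring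
  have hg_mono : (logDeriv Gammaℝ ((1 : ℂ) + charParity χ)).re ≤
      (logDeriv Gammaℝ ((φ : ℂ) + charParity χ)).re := by
    rw [eκ1, eκφ]; exact re_logDeriv_Gammaℝ_ofReal_mono (by linarith) (by linarith)
  have hg_one : (logDeriv Gammaℝ ((φ : ℂ) + charParity χ)).re -
      (logDeriv Gammaℝ ((1 : ℂ) + charParity χ)).re ≤ 1 := by
    rw [eκ1, eκφ]; exact re_logDeriv_Gammaℝ_ofReal_sub_le_one (by linarith) (by linarith) (by linarith)
  have hg_nonpos : (logDeriv Gammaℝ ((φ : ℂ) + charParity χ)).re ≤ 0 := by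
    rw [eκφ]; exact re_logDeriv_Gammaℝ_ofReal_nonpos₄ (by linarith) (by linarith)
  have hFεg : F * ε * (logDeriv Gammaℝ ((φ : ℂ) + charParity χ)).re ≤ 0 :=
    mul_nonpos_of_nonneg_of_nonpos hFε0 hg_nonpos
  -- `|Re L'/L(φ, χ)| < 1/ε = r`
  have hLφ := abs_re_logDeriv_LFunction_ofReal_lt χ hφ1 hφ2
  rw [show φ - 1 = ε by rw [hφ]; ring, hinvε, abs_lt] at hLφ
  have hFεℓ : F * ε * (deriv χ.LFunction φ / χ.LFunction φ).re ≤ F * ε * r :=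
    mul_le_mul_of_nonneg_left hLφ.2.le hFε0
  have hFεℓ' : F * ε * (-r) ≤ F * ε * (deriv χ.LFunction φ / χ.LFunction φ).re :=
    mul_le_mul_of_nonneg_left hLφ.1.le hFε0
  have hnr : ∑ ρ ∈ S, (DirichletDisc.zeroOrder χ ρ : ℝ) ≤ (∑ ρ ∈ S, (DirichletDisc.zeroOrder χ ρ : ℝ)) * r :=
    le_mul_of_one_le_right hn0 hr1.le
  -- the real part of the typed difference
  have hre : (deriv χ.LFunction 1 / χ.LFunction 1 -
      ∑ ρ ∈ S, (DirichletDisc.zeroOrder χ ρ : ℂ) * (1 / (1 - ρ))).re =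
      (deriv χ.LFunction 1 / χ.LFunction 1).re -
        ∑ ρ ∈ S, (DirichletDisc.zeroOrder χ ρ : ℝ) * (1 / (1 - ρ)).re := by
    rw [Complex.sub_re, Complex.re_sum]
    congr 1
    exact Finset.sum_congr rfl fun ρ _ ↦ by rw [← Complex.ofReal_natCast, Complex.re_ofReal_mul]
  rw [hre, ← hr, abs_lt]
  have hFεrneg : F * ε * (-r) = -F := by rw [mul_neg, hFεr]
  constructor
  · linarith [hsplit1, hsplitφ, hU1, hUφ, hRL, hRφ0, h5R, h5U, hFεL, hFεr, hFεg, hFεℓ', hFεrneg, hA0, hA1,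
      hval', hO0.1, hO1.1, hAφ, hg_mono, hg_one, hsum1, hnr, hF2, hn0, hrpos, hLφ.1]
  · linarith [hsplit1, hsplitφ, hU1, hUφ, hRU, hRφ0, h5R, h5U, hFεL, hFεr, hFεg, hFεℓ, hA0, hA1,
      hval', hO0.2, hO1.2, hAφ0, hg_mono, hg_one, hsum1, hnr, hF2, hn0, hcard, hrpos, hLφ.2]


/-- **Táfula 2021, Proposition 3.2 — PROVED** (discharge of the named fact
`Literature.NumberTheory.LFunctions.tafula2021_proposition32`): from the engine
`abs_re_logDeriv_sub_pageBox_lt` and the last line of the printed proof, «taking `M = f(q) ≤ 4 log q` we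
have `f(q) ≤ 2√(f(q) log q)`», i.e. `5M + 1 ≤ 11M/2 ≤ 11√(M log q)` (`M ≥ 2`).
[cite: Tafula2021, Proposition 3.2 and its proof, §3.2 (arXiv p0006:L9–L14, p0007:L76–L105)] -/
theorem _root_.Literature.NumberTheory.LFunctions.tafula2021_proposition32_holds :
    tafula2021_proposition32 := by
  intro q _ hq χ hχ F hF2 hF4 S hS
  have h := abs_re_logDeriv_sub_pageBox_lt hq χ hχ hF2 S hS
  have hq2 : (2 : ℝ) ≤ q := by exact_mod_cast hq
  have hLq : Real.log 2 ≤ Real.log q := Real.log_le_log two_pos hq2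
  have hlog2 := Real.log_two_gt_d9
  have hrF : F / 2 ≤ Real.sqrt (F * Real.log q) := by
    have h' : Real.sqrt ((F / 2) ^ 2) ≤ Real.sqrt (F * Real.log q) :=
      Real.sqrt_le_sqrt (by nlinarith)
    rwa [Real.sqrt_sq (by linarith)] at h'
  have hn0 : 0 ≤ ∑ ρ ∈ S, (DirichletDisc.zeroOrder χ ρ : ℝ) :=
    Finset.sum_nonneg fun ρ _ ↦ Nat.cast_nonneg _
  have hnr : 0 ≤ (∑ ρ ∈ S, (DirichletDisc.zeroOrder χ ρ : ℝ)) * Real.sqrt (F * Real.log q) :=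
    mul_nonneg hn0 (Real.sqrt_nonneg _)
  nlinarith [h, hrF, hF2, hnr]

end Tafula2021

end Literature.NumberTheory.LFunctions

end
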